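import Literature.Analysis.FluidPDE.TaoCascadeRescaled
import Mathlib.Analysis.Calculus.ContDiff.Operations
import Mathlib.Analysis.Calculus.ContDiff.Comp
import Mathlib.Analysis.Calculus.Deriv.Comp
import Mathlib.Analysis.Calculus.Deriv.Add
import Mathlib.Analysis.Calculus.Deriv.Mul
import Mathlib.MeasureTheory.Integral.IntervalIntegral.Basic
import HarnessLib

/-!
# Tao's cascade ODE: iterating the rescaled step; the printed Prop. 6.5 from the corrected one

T. Tao, *Finite time blowup for an averaged three-dimensional Navier–Stokes equation*,
J. Amer. Math. Soc. 29 (2016), 601–674 = arXiv:1402.0290v3, §6.2 (p. 53) and §6.4 (Prop. 6.5,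
(6.82)–(6.84), p. 59). Equation numbers are those of arXiv v3, as in `TaoCascadeRescaled.lean`.

`TaoCascadeRescaled.lean` vendors Prop. 6.5 (the rescaled inductive step) as the statement schema
`rescaledStepWith γ` in the `X₃`-coefficient `γ` of (6.56)/(6.71), with two closed instances: the
printed one `rescaledStepPrinted` (`γ K = 10⁻⁵ exp(-K¹⁰)`) and the author-corrected one
`rescaledStepCorrected` (`γ K = 10⁻⁵ exp(-K¹⁰/2)`; erratum recorded in
`TaoCascadeBlowupDynamicsWith.lean`: the printed proof, Prop. 6.12 ⇐ Props. 6.13 + 6.15, only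
yields (6.117) `|c₁| ≲ K^{-1/4} exp(-K¹⁰/2) ε²`). Both closed instances were deprecated on
2026-08-15 (mis-stated: the schema's quantifier prefix takes `K₀` uniform in the constant `C₃` of
(6.53), whereas the source has `K` large depending on it; live named fact: `rescaledStepCorrected'`
of `TaoCascadeRescaledStepOrder.lean`), so the theorems below are stated for the schema instances
`rescaledStepWith (fun K => …)` directly, under unchanged names. This file proves, sorry-free,

* `RescaledHypotheses.succ`: **one rescaling step** — data obeying the hypotheses (i)–(ix) of
  Prop. 6.5 at level `N` and a pair `(τ₁, μ₁)` obeying its conclusion (6.67)–(6.81) yield, after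
  the rescaling (6.82)–(6.83) performed one level at a time (time dilated by
  `θ = ((1+ε₀)^{5/2} μ₁)⁻¹` around `τ₁`, amplitudes divided by `μ₁`, scales shifted by one), data
  obeying the hypotheses at level `N+1` with the same `γ, C₁, C₂` (the error constants only
  improve, by the factor `μ₁⁻¹ (1+ε₀)^{-1/2} ≤ 1`, cf. p. 59) — provided the implied constant of
  the scale-evolution bound (6.53) is taken in the summed-geometric-series form
  `L (1+ε₀)^β/((1+ε₀)^β - 1)`, `β = 5/2 + 1/100`, of the per-step lifespan bound
  `τ_k - τ_{k-1} ≤ L (1+ε₀)^{β|k-1|}` (which is what (6.14)/(6.84) give on p. 59, and which does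
  propagate, for `L ≥ 100`, by (6.67)–(6.68));
* `not_rescaledHypotheses_of_rescaledStepWith`: **the hypotheses of Prop. 6.5 refute themselves
  under Prop. 6.5** — iterating the step from any data obeying (i)–(ix) produces checkpoint times
  `T_j` bounded by a geometric series and amplitudes `a_j(T_j) = M_j ≥ (1+ε₀)^{-j/100}`, so that
  `(1+(1+ε₀)^{10j})|a_j(T_j)| ≥ (1+ε₀)^{(10-1/100)j} → ∞` on a bounded time interval, against the
  a priori regularity (6.43); this is the argument by which Prop. 6.3 implies Thm. 6.2 (§6.2,
  p. 53), run in the rescaled coordinates of §6.4. Hence `rescaledStepWith γ` holds only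
  vacuously, and
* `rescaledStepWith_anti`, `rescaledStepPrinted_of_corrected`: Prop. 6.5 with coefficient `γ`
  implies Prop. 6.5 with any smaller coefficient, in particular **the corrected-coefficient
  instance implies the printed-coefficient one** (whose hypothesis (6.56) is stronger and whose
  conclusion (6.71) is then never invoked); `rescaledStepPrinted_iff_not_rescaledHypotheses` records
  that the printed-coefficient instance is equivalent to the unsatisfiability of its own hypotheses
  in the parameter regime.

Like Props. 6.3/6.4 (which are stated under the contradiction hypothesis of Thm. 6.2, cf.
`blowupDynamicsStep_iff_noGlobalODESolution`), Prop. 6.5 thus speaks about objects — global-in-time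
data with the a priori regularity (6.43)–(6.44) — that, by the theorem it serves, do not exist; its
mathematical content is the inductive mechanism `RescaledHypotheses → RescaledConclusion`, which a
proof of `rescaledStepCorrected'` (§6.5–6.7) has to supply and which only uses the data on
`[τ_{n₀-N}, 100]`.

## Design

The rescaled data enter `RescaledHypotheses.succ` as variables `τ', Y', F'` constrained by
pointwise equations (`hτ'`, `hY'`, `hF'`), so that the step can be iterated with closed-form data
`M_j⁻¹ Y i (k+j) (T_j + Θ_j t)` built from the starting level. Derivatives are one-sided within
half-lines (`derivWithin _ (Ici _)`) as in `TaoODESystem`; the chain rule and the change of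
variables in the defect integral (6.51) are the elementary lemmas of `RescaledShift`. Nothing here
uses the size of `K`, `ε` or `n₀`: the step is exact bookkeeping, valid for `0 < ε₀`, `0 < K`.

## References

* T. Tao, J. Amer. Math. Soc. 29 (2016), 601–674 = arXiv:1402.0290v3, §6.2 p. 53 ("Let us now
  see how the above proposition implies Theorem 6.2"), §6.4 Prop. 6.5 (6.43)–(6.81), the
  rescaling (6.82)–(6.84) and p. 59, §6.6 Prop. 6.13 (6.117). [`Tao2016AveragedNS`]
* T. Tao, blog page of the paper, comment of 2017-03-31 and reply (the erratum to
  (6.17)/(6.32)/(6.71)/(6.108)). [`TaoBlog2014AveragedNSErratum`]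
-/

noncomputable section

open Set MeasureTheory

namespace Literature.Analysis.FluidPDE

namespace TaoCascade

/-! ## The one-step rescaling: elementary lemmas -/

namespace RescaledShift

/-! ## Affine reparametrisation within half-lines -/

/-- Chain rule for an affine, orientation-preserving change of time within half-lines: if
`s₀ + θ a' = a`, `θ > 0`, `a' ≤ t` and `f` is differentiable within `[a, ∞)` at `s₀ + θ t`, then
`d/dt (c f(s₀ + θ t))` within `[a', ∞)` is `c θ f'(s₀ + θ t)`. [folklore] -/
theorem derivWithin_const_mul_comp_affine {f : ℝ → ℝ} {c θ s₀ a a' t : ℝ} (hθ : 0 < θ)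
    (ha : s₀ + θ * a' = a) (ht : a' ≤ t)
    (hf : DifferentiableWithinAt ℝ f (Ici a) (s₀ + θ * t)) :
    derivWithin (fun u => c * f (s₀ + θ * u)) (Ici a') t =
      c * θ * derivWithin f (Ici a) (s₀ + θ * t) := by
  have hg : HasDerivWithinAt (fun u : ℝ => s₀ + θ * u) θ (Ici a') t := by
    have h1 : HasDerivAt (fun u : ℝ => s₀ + θ * u) (0 + θ * 1) t :=
      (hasDerivAt_const t s₀).add ((hasDerivAt_id t).const_mul θ)
    simpa using h1.hasDerivWithinAt
  have hmaps : MapsTo (fun u : ℝ => s₀ + θ * u) (Ici a') (Ici a) := by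
    intro u hu
    simp only [mem_Ici] at hu ⊢
    rw [← ha]
    nlinarith
  have hcomp : HasDerivWithinAt (fun u => f (s₀ + θ * u))
      (derivWithin f (Ici a) (s₀ + θ * t) * θ) (Ici a') t :=
    hf.hasDerivWithinAt.comp t hg hmaps
  have hmul := hcomp.const_mul c
  rw [hmul.derivWithin (uniqueDiffOn_Ici a' t ht)]
  ring

/-- An affine, orientation-preserving change of time maps `C¹` functions on `[a, ∞)` to `C¹`
functions on `[a', ∞)` (`s₀ + θ a' = a`, `θ > 0`). [folklore] -/
theorem contDiffOn_const_mul_comp_affine {f : ℝ → ℝ} {c θ s₀ a a' : ℝ} (hθ : 0 < θ)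
    (ha : s₀ + θ * a' = a) (hf : ContDiffOn ℝ 1 f (Ici a)) :
    ContDiffOn ℝ 1 (fun u => c * f (s₀ + θ * u)) (Ici a') := by
  have hmaps : MapsTo (fun u : ℝ => s₀ + θ * u) (Ici a') (Ici a) := by
    intro u hu
    simp only [mem_Ici] at hu ⊢
    rw [← ha]
    nlinarith
  have hg : ContDiffOn ℝ 1 (fun u : ℝ => s₀ + θ * u) (Ici a') :=
    ((contDiff_const (c := s₀)).add ((contDiff_const (c := θ)).mul contDiff_id)).contDiffOn
  exact (contDiffOn_const (c := c)).mul (hf.comp hg hmaps)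

/-- Change of variables `s = s₀ + θ u` in an interval integral, with a constant factor.
[folklore] -/
theorem integral_const_mul_comp_affine (f : ℝ → ℝ) {c θ s₀ : ℝ} (hθ : θ ≠ 0) (a' t : ℝ) :
    ∫ u in a'..t, c * f (s₀ + θ * u) = c * θ⁻¹ * ∫ s in (s₀ + θ * a')..(s₀ + θ * t), f s := by
  rw [intervalIntegral.integral_const_mul, intervalIntegral.integral_comp_add_mul f hθ s₀]
  simp [smul_eq_mul, mul_assoc]

/-- `√(μ⁻² x) = μ⁻¹ √x` for `μ > 0`. [folklore] -/
theorem sqrt_inv_sq_mul {μ x : ℝ} (hμ : 0 < μ) : Real.sqrt ((μ ^ 2)⁻¹ * x) = μ⁻¹ * Real.sqrt x := by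
  rw [Real.sqrt_mul (by positivity), Real.sqrt_inv, Real.sqrt_sq hμ.le]

/-! ## Scalar bookkeeping for one rescaling step -/

section Scalars

variable {ε₀ μ₁ : ℝ}

/-- `μ₁⁻¹ ≤ (1+ε₀)^{1/100}` from (6.68). [cite: Tao2016AveragedNS, §6.4 Prop. 6.5 (6.68)] -/
theorem inv_mu_le (hε₀ : 0 < ε₀) (hμ : (1 + ε₀) ^ (-(1 : ℝ) / 100) ≤ μ₁) :
    μ₁⁻¹ ≤ (1 + ε₀) ^ ((1 : ℝ) / 100) := by
  have hq : (0 : ℝ) < 1 + ε₀ := by linarith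
  have hpos : 0 < (1 + ε₀) ^ (-(1 : ℝ) / 100) := Real.rpow_pos_of_pos hq _
  calc μ₁⁻¹ ≤ ((1 + ε₀) ^ (-(1 : ℝ) / 100))⁻¹ := inv_anti₀ hpos hμ
    _ = (1 + ε₀) ^ ((1 : ℝ) / 100) := by
      rw [← Real.rpow_neg hq.le]; congr 1; ring

/-- `μ₁⁻² ≤ (1+ε₀)^{1/50}` from (6.68). [cite: Tao2016AveragedNS, §6.4 Prop. 6.5 (6.68)] -/
theorem inv_mu_sq_le (hε₀ : 0 < ε₀) (hμ : (1 + ε₀) ^ (-(1 : ℝ) / 100) ≤ μ₁) :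
    (μ₁ ^ 2)⁻¹ ≤ (1 + ε₀) ^ ((1 : ℝ) / 50) := by
  have hq : (0 : ℝ) < 1 + ε₀ := by linarith
  have hμpos : 0 < μ₁ := (Real.rpow_pos_of_pos hq _).trans_le hμ
  have h1 := inv_mu_le hε₀ hμ
  have h0 : 0 ≤ μ₁⁻¹ := by positivity
  calc (μ₁ ^ 2)⁻¹ = μ₁⁻¹ * μ₁⁻¹ := by rw [← inv_pow]; ring
    _ ≤ (1 + ε₀) ^ ((1 : ℝ) / 100) * (1 + ε₀) ^ ((1 : ℝ) / 100) :=
        mul_le_mul h1 h1 h0 (Real.rpow_pos_of_pos hq _).le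
    _ = (1 + ε₀) ^ ((1 : ℝ) / 50) := by rw [← Real.rpow_add hq]; norm_num

/-- The error coefficients only improve under one rescaling step:
`μ₁⁻¹ (1+ε₀)^{-5/2} (1+ε₀)² ≤ 1`. [cite: Tao2016AveragedNS, §6.4 p. 59] -/
theorem inv_mu_mul_scale_le_one (hε₀ : 0 < ε₀) (hμ : (1 + ε₀) ^ (-(1 : ℝ) / 100) ≤ μ₁) :
    μ₁⁻¹ * ((1 + ε₀) ^ ((5 : ℝ) / 2))⁻¹ * (1 + ε₀) ^ (2 : ℝ) ≤ 1 := by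
  have hq : (0 : ℝ) < 1 + ε₀ := by linarith
  have hq1 : (1 : ℝ) ≤ 1 + ε₀ := by linarith
  have h1 := inv_mu_le hε₀ hμ
  have hr : ((1 + ε₀) ^ ((5 : ℝ) / 2))⁻¹ * (1 + ε₀) ^ (2 : ℝ) = (1 + ε₀) ^ (-(1 : ℝ) / 2) := by
    rw [← Real.rpow_neg hq.le, ← Real.rpow_add hq]; norm_num
  calc μ₁⁻¹ * ((1 + ε₀) ^ ((5 : ℝ) / 2))⁻¹ * (1 + ε₀) ^ (2 : ℝ)
      = μ₁⁻¹ * (1 + ε₀) ^ (-(1 : ℝ) / 2) := by rw [mul_assoc, hr]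
    _ ≤ (1 + ε₀) ^ ((1 : ℝ) / 100) * (1 + ε₀) ^ (-(1 : ℝ) / 2) := by
        gcongr
    _ = (1 + ε₀) ^ (-(49 : ℝ) / 100) := by rw [← Real.rpow_add hq]; norm_num
    _ ≤ 1 := Real.rpow_le_one_of_one_le_of_nonpos hq1 (by norm_num)

/-- `(1+ε₀)² θ ≤ 1` for the time dilation `θ = ((1+ε₀)^{5/2} μ₁)⁻¹` of one rescaling step.
[cite: Tao2016AveragedNS, §6.4 p. 59] -/
theorem scale_sq_mul_theta_le_one (hε₀ : 0 < ε₀) (hμ : (1 + ε₀) ^ (-(1 : ℝ) / 100) ≤ μ₁) :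
    (1 + ε₀) ^ (2 : ℝ) * ((1 + ε₀) ^ ((5 : ℝ) / 2) * μ₁)⁻¹ ≤ 1 := by
  have h := inv_mu_mul_scale_le_one hε₀ hμ
  calc (1 + ε₀) ^ (2 : ℝ) * ((1 + ε₀) ^ ((5 : ℝ) / 2) * μ₁)⁻¹
      = μ₁⁻¹ * ((1 + ε₀) ^ ((5 : ℝ) / 2))⁻¹ * (1 + ε₀) ^ (2 : ℝ) := by rw [mul_inv]; ring
    _ ≤ 1 := h

/-- The main factor shifts by one scale: `(1+ε₀)^{5k/2} = (1+ε₀)^{-5/2} (1+ε₀)^{5(k+1)/2}`.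
[cite: Tao2016AveragedNS, §6.4 p. 59] -/
theorem rpow_main_shift (hε₀ : 0 < ε₀) (k : ℤ) :
    (1 + ε₀) ^ ((5 : ℝ) * k / 2) =
      ((1 + ε₀) ^ ((5 : ℝ) / 2))⁻¹ * (1 + ε₀) ^ ((5 : ℝ) * ((k + 1 : ℤ) : ℝ) / 2) := by
  have hq : (0 : ℝ) < 1 + ε₀ := by linarith
  rw [← Real.rpow_neg hq.le, ← Real.rpow_add hq]
  congr 1; push_cast; ring

/-- The error factor shifts by one scale:
`(1+ε₀)^{2(k+1) - n₀/2} = (1+ε₀)^{2k - n₀/2} (1+ε₀)²`. [cite: Tao2016AveragedNS, §6.4 p. 59] -/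
theorem rpow_err_shift (hε₀ : 0 < ε₀) (k n₀ : ℤ) :
    (1 + ε₀) ^ ((2 : ℝ) * ((k + 1 : ℤ) : ℝ) - n₀ / 2) =
      (1 + ε₀) ^ ((2 : ℝ) * k - n₀ / 2) * (1 + ε₀) ^ (2 : ℝ) := by
  have hq : (0 : ℝ) < 1 + ε₀ := by linarith
  rw [← Real.rpow_add hq]
  congr 1; push_cast; ring

end Scalars

/-! ## One rescaling step: from level `N` to level `N+1`

Given data `τ, Y, F` obeying the hypotheses of Prop. 6.5 at level `N` and a pair `(τ₁, μ₁)` obeying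
its conclusion, the rescaled-and-shifted data
`Y' i k t = μ₁⁻¹ Y i (k+1) (τ₁ + θ t)`, `F' k t = μ₁⁻² F (k+1) (τ₁ + θ t)`,
`τ' k = (τ̂ (k+1) - τ₁)/θ` with `θ = ((1+ε₀)^{5/2} μ₁)⁻¹` and `τ̂ = τ` updated by `τ̂ 1 = τ₁`,
obey the hypotheses at level `N+1` (this is the rescaling (6.82)–(6.83) of §6.4 performed one
level at a time). The data `τ', Y', F'` enter as variables constrained by pointwise equations. -/

section Succ

variable {γ ε₀ K ε C₁ C₂ C₃ : ℝ} {n₀ N : ℤ} {τ : ℤ → ℝ} {Y : Fin 4 → ℤ → ℝ → ℝ} {F : ℤ → ℝ → ℝ}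
  {τ₁ μ₁ θ : ℝ} {τ' : ℤ → ℝ} {Y' : Fin 4 → ℤ → ℝ → ℝ} {F' : ℤ → ℝ → ℝ}

/-- The time dilation of one rescaling step is positive. [cite: Tao2016AveragedNS, §6.4 (6.82)] -/
theorem theta_pos (hε₀ : 0 < ε₀) (hμ : 0 < μ₁) (hθ : θ = ((1 + ε₀) ^ ((5 : ℝ) / 2) * μ₁)⁻¹) :
    0 < θ := by
  have hq : (0 : ℝ) < 1 + ε₀ := by linarith
  rw [hθ]
  exact inv_pos.mpr (mul_pos (Real.rpow_pos_of_pos hq _) hμ)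

/-- `τ'₀ = 0`. [cite: Tao2016AveragedNS, §6.4 (6.82)] -/
theorem tau'_zero (hτ' : ∀ k, τ' k = (Function.update τ 1 τ₁ (k + 1) - τ₁) / θ) : τ' 0 = 0 := by
  rw [hτ']; simp

/-- `τ'_k = (τ_{k+1} - τ₁)/θ` for `k ≠ 0`. [cite: Tao2016AveragedNS, §6.4 (6.82)] -/
theorem tau'_of_ne (hτ' : ∀ k, τ' k = (Function.update τ 1 τ₁ (k + 1) - τ₁) / θ) {k : ℤ}
    (hk : k ≠ 0) : τ' k = (τ (k + 1) - τ₁) / θ := by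
  rw [hτ', Function.update_of_ne (by omega)]

/-- The new base time is the old one: `τ₁ + θ τ'_{n₀-(N+1)} = τ_{n₀-N}`.
[cite: Tao2016AveragedNS, §6.4 (6.82)] -/
theorem base_eq (hθ0 : θ ≠ 0) (hN : n₀ ≤ N)
    (hτ' : ∀ k, τ' k = (Function.update τ 1 τ₁ (k + 1) - τ₁) / θ) :
    τ₁ + θ * τ' (n₀ - (N + 1)) = τ (n₀ - N) := by
  rw [tau'_of_ne hτ' (by omega), show n₀ - (N + 1) + 1 = n₀ - N by ring]
  field_simp
  ring

/-- Old and new times correspond: `τ'_{n₀-(N+1)} ≤ t ↔ τ_{n₀-N} ≤ τ₁ + θ t`.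
[cite: Tao2016AveragedNS, §6.4 (6.82)] -/
theorem base_le_iff (hθ : 0 < θ) (hN : n₀ ≤ N)
    (hτ' : ∀ k, τ' k = (Function.update τ 1 τ₁ (k + 1) - τ₁) / θ) (t : ℝ) :
    τ' (n₀ - (N + 1)) ≤ t ↔ τ (n₀ - N) ≤ τ₁ + θ * t := by
  rw [← base_eq hθ.ne' hN hτ']
  constructor
  · intro h; nlinarith
  · intro h; nlinarith

/-- For `k ≤ -1`, `t ∈ [τ'_{k-1}, τ'_k]` corresponds to `τ₁ + θ t ∈ [τ_k, τ_{k+1}]`.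
[cite: Tao2016AveragedNS, §6.4 (6.82)] -/
theorem mem_Icc_of_mem_Icc_neg (hθ : 0 < θ)
    (hτ' : ∀ k, τ' k = (Function.update τ 1 τ₁ (k + 1) - τ₁) / θ) {k : ℤ} (hk : k ≤ -1) {t : ℝ}
    (ht : t ∈ Icc (τ' (k - 1)) (τ' k)) : τ₁ + θ * t ∈ Icc (τ k) (τ (k + 1)) := by
  rw [tau'_of_ne hτ' (show k - 1 ≠ 0 by omega), tau'_of_ne hτ' (show k ≠ 0 by omega),
    show k - 1 + 1 = k by ring] at ht
  obtain ⟨h1, h2⟩ := ht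
  rw [div_le_iff₀ hθ] at h1
  rw [le_div_iff₀ hθ] at h2
  constructor <;> linarith

/-- For `k = 0`, `t ∈ [τ'_{-1}, τ'_0]` corresponds to `τ₁ + θ t ∈ [0, τ₁]` (as `τ₀ = 0`).
[cite: Tao2016AveragedNS, §6.4 (6.82)] -/
theorem mem_Icc_of_mem_Icc_zero (hθ : 0 < θ) (h0 : τ 0 = 0)
    (hτ' : ∀ k, τ' k = (Function.update τ 1 τ₁ (k + 1) - τ₁) / θ) {t : ℝ}
    (ht : t ∈ Icc (τ' (0 - 1)) (τ' 0)) : τ₁ + θ * t ∈ Icc 0 τ₁ := by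
  rw [tau'_of_ne hτ' (show (0 : ℤ) - 1 ≠ 0 by omega), tau'_zero hτ',
    show (0 : ℤ) - 1 + 1 = 0 by ring, h0] at ht
  obtain ⟨h1, h2⟩ := ht
  rw [div_le_iff₀ hθ] at h1
  constructor <;> nlinarith

/-! ### Regularity, support and a priori bounds at level `N+1` -/

/-- `Y'` is `C¹` on the new half-line. [cite: Tao2016AveragedNS, §6.4 Prop. 6.5 (i)] -/
theorem succ_contDiffOn_Y (hε₀ : 0 < ε₀) (hN : n₀ ≤ N)
    (h : RescaledHypotheses γ ε₀ K ε C₁ C₂ C₃ n₀ N τ Y F) (hμ : 0 < μ₁)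
    (hθ : θ = ((1 + ε₀) ^ ((5 : ℝ) / 2) * μ₁)⁻¹)
    (hτ' : ∀ k, τ' k = (Function.update τ 1 τ₁ (k + 1) - τ₁) / θ)
    (hY' : ∀ i k t, Y' i k t = μ₁⁻¹ * Y i (k + 1) (τ₁ + θ * t)) (i : Fin 4) (k : ℤ) :
    ContDiffOn ℝ 1 (Y' i k) (Ici (τ' (n₀ - (N + 1)))) := by
  have hθp := theta_pos hε₀ hμ hθ
  have hfun : Y' i k = fun t => μ₁⁻¹ * Y i (k + 1) (τ₁ + θ * t) := funext (hY' i k)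
  rw [hfun]
  exact contDiffOn_const_mul_comp_affine hθp (base_eq hθp.ne' hN hτ') (h.contDiffOn_Y i (k + 1))

/-- `F'` is `C¹` on the new half-line. [cite: Tao2016AveragedNS, §6.4 Prop. 6.5 (i)] -/
theorem succ_contDiffOn_F (hε₀ : 0 < ε₀) (hN : n₀ ≤ N)
    (h : RescaledHypotheses γ ε₀ K ε C₁ C₂ C₃ n₀ N τ Y F) (hμ : 0 < μ₁)
    (hθ : θ = ((1 + ε₀) ^ ((5 : ℝ) / 2) * μ₁)⁻¹)
    (hτ' : ∀ k, τ' k = (Function.update τ 1 τ₁ (k + 1) - τ₁) / θ)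
    (hF' : ∀ k t, F' k t = (μ₁ ^ 2)⁻¹ * F (k + 1) (τ₁ + θ * t)) (k : ℤ) :
    ContDiffOn ℝ 1 (F' k) (Ici (τ' (n₀ - (N + 1)))) := by
  have hθp := theta_pos hε₀ hμ hθ
  have hfun : F' k = fun t => (μ₁ ^ 2)⁻¹ * F (k + 1) (τ₁ + θ * t) := funext (hF' k)
  rw [hfun]
  exact contDiffOn_const_mul_comp_affine hθp (base_eq hθp.ne' hN hτ') (h.contDiffOn_F (k + 1))

/-- `F' ≥ 0` on the new half-line. [cite: Tao2016AveragedNS, §6.4 Prop. 6.5 (i)] -/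
theorem succ_nonneg_F (hε₀ : 0 < ε₀) (hN : n₀ ≤ N)
    (h : RescaledHypotheses γ ε₀ K ε C₁ C₂ C₃ n₀ N τ Y F) (hμ : 0 < μ₁)
    (hθ : θ = ((1 + ε₀) ^ ((5 : ℝ) / 2) * μ₁)⁻¹)
    (hτ' : ∀ k, τ' k = (Function.update τ 1 τ₁ (k + 1) - τ₁) / θ)
    (hF' : ∀ k t, F' k t = (μ₁ ^ 2)⁻¹ * F (k + 1) (τ₁ + θ * t)) (k : ℤ) (t : ℝ)
    (ht : τ' (n₀ - (N + 1)) ≤ t) : 0 ≤ F' k t := by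
  have hθp := theta_pos hε₀ hμ hθ
  rw [hF']
  exact mul_nonneg (by positivity) (h.nonneg_F _ _ ((base_le_iff hθp hN hτ' t).1 ht))

/-- (6.43) at level `N+1`. [cite: Tao2016AveragedNS, §6.4 Prop. 6.5 (6.43)] -/
theorem succ_apriori_Y (hε₀ : 0 < ε₀) (hN : n₀ ≤ N)
    (h : RescaledHypotheses γ ε₀ K ε C₁ C₂ C₃ n₀ N τ Y F) (hμ : 0 < μ₁)
    (hθ : θ = ((1 + ε₀) ^ ((5 : ℝ) / 2) * μ₁)⁻¹)
    (hτ' : ∀ k, τ' k = (Function.update τ 1 τ₁ (k + 1) - τ₁) / θ)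
    (hY' : ∀ i k t, Y' i k t = μ₁⁻¹ * Y i (k + 1) (τ₁ + θ * t)) (T : ℝ)
    (hT : τ' (n₀ - (N + 1)) < T) :
    ∃ M : ℝ, ∀ t ∈ Icc (τ' (n₀ - (N + 1))) T, ∀ k : ℤ,
      (1 + (1 + ε₀) ^ ((10 : ℝ) * k)) *
        (|Y' 0 k t| + |Y' 1 k t| + |Y' 2 k t| + |Y' 3 k t|) ≤ M := by
  have hθp := theta_pos hε₀ hμ hθ
  have hq : (0 : ℝ) < 1 + ε₀ := by linarith
  have hq1 : (1 : ℝ) ≤ 1 + ε₀ := by linarith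
  have hbase := base_eq hθp.ne' hN hτ'
  have hT' : τ (n₀ - N) < τ₁ + θ * T := by rw [← hbase]; nlinarith
  obtain ⟨M, hM⟩ := h.apriori_Y (τ₁ + θ * T) hT'
  have hM0 : 0 ≤ M := by
    have := hM (τ (n₀ - N)) ⟨le_rfl, hT'.le⟩ 0
    exact le_trans (by positivity) this
  refine ⟨μ₁⁻¹ * M, fun t ht k => ?_⟩
  have hs : τ₁ + θ * t ∈ Icc (τ (n₀ - N)) (τ₁ + θ * T) := by
    rw [← hbase]; constructor <;> nlinarith [ht.1, ht.2]
  have hold := hM (τ₁ + θ * t) hs (k + 1)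
  have hw : 1 + (1 + ε₀) ^ ((10 : ℝ) * k) ≤ 1 + (1 + ε₀) ^ ((10 : ℝ) * ((k + 1 : ℤ) : ℝ)) := by
    gcongr
    · linarith
  have hw0 : 0 ≤ 1 + (1 + ε₀) ^ ((10 : ℝ) * k) := by positivity
  simp only [hY', abs_mul, abs_inv, abs_of_pos hμ]
  have hsum0 : 0 ≤ |Y 0 (k + 1) (τ₁ + θ * t)| + |Y 1 (k + 1) (τ₁ + θ * t)| +
      |Y 2 (k + 1) (τ₁ + θ * t)| + |Y 3 (k + 1) (τ₁ + θ * t)| := by positivity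
  calc (1 + (1 + ε₀) ^ ((10 : ℝ) * k)) *
        (μ₁⁻¹ * |Y 0 (k + 1) (τ₁ + θ * t)| + μ₁⁻¹ * |Y 1 (k + 1) (τ₁ + θ * t)| +
          μ₁⁻¹ * |Y 2 (k + 1) (τ₁ + θ * t)| + μ₁⁻¹ * |Y 3 (k + 1) (τ₁ + θ * t)|)
      = μ₁⁻¹ * ((1 + (1 + ε₀) ^ ((10 : ℝ) * k)) *
          (|Y 0 (k + 1) (τ₁ + θ * t)| + |Y 1 (k + 1) (τ₁ + θ * t)| +
            |Y 2 (k + 1) (τ₁ + θ * t)| + |Y 3 (k + 1) (τ₁ + θ * t)|)) := by ring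
    _ ≤ μ₁⁻¹ * ((1 + (1 + ε₀) ^ ((10 : ℝ) * ((k + 1 : ℤ) : ℝ))) *
          (|Y 0 (k + 1) (τ₁ + θ * t)| + |Y 1 (k + 1) (τ₁ + θ * t)| +
            |Y 2 (k + 1) (τ₁ + θ * t)| + |Y 3 (k + 1) (τ₁ + θ * t)|)) := by
        gcongr
    _ ≤ μ₁⁻¹ * M := by gcongr

/-- (6.44) at level `N+1`. [cite: Tao2016AveragedNS, §6.4 Prop. 6.5 (6.44)] -/
theorem succ_apriori_F (hε₀ : 0 < ε₀) (hN : n₀ ≤ N)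
    (h : RescaledHypotheses γ ε₀ K ε C₁ C₂ C₃ n₀ N τ Y F) (hμ : 0 < μ₁)
    (hθ : θ = ((1 + ε₀) ^ ((5 : ℝ) / 2) * μ₁)⁻¹)
    (hτ' : ∀ k, τ' k = (Function.update τ 1 τ₁ (k + 1) - τ₁) / θ)
    (hF' : ∀ k t, F' k t = (μ₁ ^ 2)⁻¹ * F (k + 1) (τ₁ + θ * t)) (T : ℝ)
    (hT : τ' (n₀ - (N + 1)) < T) :
    ∃ M : ℝ, ∀ t ∈ Icc (τ' (n₀ - (N + 1))) T, ∀ k : ℤ,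
      (1 + (1 + ε₀) ^ ((10 : ℝ) * k)) * Real.sqrt (F' k t) ≤ M := by
  have hθp := theta_pos hε₀ hμ hθ
  have hq : (0 : ℝ) < 1 + ε₀ := by linarith
  have hq1 : (1 : ℝ) ≤ 1 + ε₀ := by linarith
  have hbase := base_eq hθp.ne' hN hτ'
  have hT' : τ (n₀ - N) < τ₁ + θ * T := by rw [← hbase]; nlinarith
  obtain ⟨M, hM⟩ := h.apriori_F (τ₁ + θ * T) hT'
  have hM0 : 0 ≤ M := by
    have := hM (τ (n₀ - N)) ⟨le_rfl, hT'.le⟩ 0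
    exact le_trans (by positivity) this
  refine ⟨μ₁⁻¹ * M, fun t ht k => ?_⟩
  have hs : τ₁ + θ * t ∈ Icc (τ (n₀ - N)) (τ₁ + θ * T) := by
    rw [← hbase]; constructor <;> nlinarith [ht.1, ht.2]
  have hold := hM (τ₁ + θ * t) hs (k + 1)
  have hw : 1 + (1 + ε₀) ^ ((10 : ℝ) * k) ≤ 1 + (1 + ε₀) ^ ((10 : ℝ) * ((k + 1 : ℤ) : ℝ)) := by
    gcongr
    · linarith
  have hw0 : 0 ≤ 1 + (1 + ε₀) ^ ((10 : ℝ) * k) := by positivity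
  rw [hF', sqrt_inv_sq_mul hμ]
  have hs0 : 0 ≤ Real.sqrt (F (k + 1) (τ₁ + θ * t)) := Real.sqrt_nonneg _
  calc (1 + (1 + ε₀) ^ ((10 : ℝ) * k)) * (μ₁⁻¹ * Real.sqrt (F (k + 1) (τ₁ + θ * t)))
      = μ₁⁻¹ * ((1 + (1 + ε₀) ^ ((10 : ℝ) * k)) * Real.sqrt (F (k + 1) (τ₁ + θ * t))) := by ring
    _ ≤ μ₁⁻¹ * ((1 + (1 + ε₀) ^ ((10 : ℝ) * ((k + 1 : ℤ) : ℝ))) *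
          Real.sqrt (F (k + 1) (τ₁ + θ * t))) := by gcongr
    _ ≤ μ₁⁻¹ * M := by gcongr

/-- (6.50), modes, at level `N+1`. [cite: Tao2016AveragedNS, §6.4 Prop. 6.5 (6.50)] -/
theorem succ_init_Y (hε₀ : 0 < ε₀) (hN : n₀ ≤ N)
    (h : RescaledHypotheses γ ε₀ K ε C₁ C₂ C₃ n₀ N τ Y F) (hμ : 0 < μ₁)
    (hθ : θ = ((1 + ε₀) ^ ((5 : ℝ) / 2) * μ₁)⁻¹)
    (hτ' : ∀ k, τ' k = (Function.update τ 1 τ₁ (k + 1) - τ₁) / θ)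
    (hY' : ∀ i k t, Y' i k t = μ₁⁻¹ * Y i (k + 1) (τ₁ + θ * t)) (i : Fin 4) (k : ℤ)
    (hk : n₀ - (N + 1) < k) : Y' i k (τ' (n₀ - (N + 1))) = 0 := by
  have hθp := theta_pos hε₀ hμ hθ
  rw [hY', base_eq hθp.ne' hN hτ', h.init_Y i (k + 1) (by omega), mul_zero]

/-- (6.50), energies, at level `N+1`. [cite: Tao2016AveragedNS, §6.4 Prop. 6.5 (6.50)] -/
theorem succ_init_F (hε₀ : 0 < ε₀) (hN : n₀ ≤ N)
    (h : RescaledHypotheses γ ε₀ K ε C₁ C₂ C₃ n₀ N τ Y F) (hμ : 0 < μ₁)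
    (hθ : θ = ((1 + ε₀) ^ ((5 : ℝ) / 2) * μ₁)⁻¹)
    (hτ' : ∀ k, τ' k = (Function.update τ 1 τ₁ (k + 1) - τ₁) / θ)
    (hF' : ∀ k t, F' k t = (μ₁ ^ 2)⁻¹ * F (k + 1) (τ₁ + θ * t)) (k : ℤ)
    (hk : n₀ - (N + 1) < k) : F' k (τ' (n₀ - (N + 1))) = 0 := by
  have hθp := theta_pos hε₀ hμ hθ
  rw [hF', base_eq hθp.ne' hN hτ', h.init_F (k + 1) (by omega), mul_zero]

/-- (6.52), modes, at level `N+1`. [cite: Tao2016AveragedNS, §6.4 Prop. 6.5 (6.52)] -/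
theorem succ_noLow_Y (hε₀ : 0 < ε₀) (hN : n₀ ≤ N)
    (h : RescaledHypotheses γ ε₀ K ε C₁ C₂ C₃ n₀ N τ Y F) (hμ : 0 < μ₁)
    (hθ : θ = ((1 + ε₀) ^ ((5 : ℝ) / 2) * μ₁)⁻¹)
    (hτ' : ∀ k, τ' k = (Function.update τ 1 τ₁ (k + 1) - τ₁) / θ)
    (hY' : ∀ i k t, Y' i k t = μ₁⁻¹ * Y i (k + 1) (τ₁ + θ * t)) (i : Fin 4) (k : ℤ) (t : ℝ)
    (hk : k < n₀ - (N + 1)) (ht : τ' (n₀ - (N + 1)) ≤ t) : Y' i k t = 0 := by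
  have hθp := theta_pos hε₀ hμ hθ
  rw [hY', h.noLow_Y i (k + 1) _ (by omega) ((base_le_iff hθp hN hτ' t).1 ht), mul_zero]

/-- (6.52), energies, at level `N+1`. [cite: Tao2016AveragedNS, §6.4 Prop. 6.5 (6.52)] -/
theorem succ_noLow_F (hε₀ : 0 < ε₀) (hN : n₀ ≤ N)
    (h : RescaledHypotheses γ ε₀ K ε C₁ C₂ C₃ n₀ N τ Y F) (hμ : 0 < μ₁)
    (hθ : θ = ((1 + ε₀) ^ ((5 : ℝ) / 2) * μ₁)⁻¹)
    (hτ' : ∀ k, τ' k = (Function.update τ 1 τ₁ (k + 1) - τ₁) / θ)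
    (hF' : ∀ k t, F' k t = (μ₁ ^ 2)⁻¹ * F (k + 1) (τ₁ + θ * t)) (k : ℤ) (t : ℝ)
    (hk : k < n₀ - (N + 1)) (ht : τ' (n₀ - (N + 1)) ≤ t) : F' k t = 0 := by
  have hθp := theta_pos hε₀ hμ hθ
  rw [hF', h.noLow_F (k + 1) _ (by omega) ((base_le_iff hθp hN hτ' t).1 ht), mul_zero]

/-! ### The new checkpoint times -/

/-- Consecutive new times increase. [cite: Tao2016AveragedNS, §6.4 Prop. 6.5] -/
theorem succ_tau_lt (h : RescaledHypotheses γ ε₀ K ε C₁ C₂ C₃ n₀ N τ Y F) (hθp : 0 < θ)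
    (hτ₁ : 0 < τ₁) (hτ' : ∀ k, τ' k = (Function.update τ 1 τ₁ (k + 1) - τ₁) / θ) (k : ℤ)
    (hk : n₀ - (N + 1) < k) (hk0 : k ≤ 0) : τ' (k - 1) < τ' k := by
  rcases eq_or_lt_of_le hk0 with rfl | hlt
  · rw [tau'_zero hτ', tau'_of_ne hτ' (by omega), show (0 : ℤ) - 1 + 1 = 0 by ring, h.tau_zero]
    exact div_neg_of_neg_of_pos (by linarith) hθp
  · rw [tau'_of_ne hτ' (by omega), tau'_of_ne hτ' (by omega), show k - 1 + 1 = k by ring]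
    have := h.tau_lt (k + 1) (by omega) (by omega)
    rw [show k + 1 - 1 = k by ring] at this
    exact div_lt_div_of_pos_right (by linarith) hθp

/-- (6.53), upper bound, at level `N+1`. [cite: Tao2016AveragedNS, §6.4 Prop. 6.5 (6.53)] -/
theorem succ_tau_le (h : RescaledHypotheses γ ε₀ K ε C₁ C₂ C₃ n₀ N τ Y F) (hθp : 0 < θ)
    (hτ₁ : 0 < τ₁) (hτ' : ∀ k, τ' k = (Function.update τ 1 τ₁ (k + 1) - τ₁) / θ) (k : ℤ)
    (hk : n₀ - (N + 1) ≤ k) (hk0 : k ≤ 0) : τ' k ≤ 0 := by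
  rcases eq_or_lt_of_le hk0 with rfl | hlt
  · rw [tau'_zero hτ']
  · rw [tau'_of_ne hτ' (by omega)]
    have := h.tau_le (k + 1) (by omega) (by omega)
    exact div_nonpos_of_nonpos_of_nonneg (by linarith) hθp.le

/-! ### The transition state (viii) at level `N+1` -/

/-- (6.54)–(6.59) and (6.60)–(6.63) at level `N+1` are (6.69)–(6.74) and (6.75)–(6.78) rescaled by
`μ₁`. [cite: Tao2016AveragedNS, §6.4 Prop. 6.5 (6.54)–(6.63), (6.69)–(6.78)] -/
theorem succ_state (hc : RescaledConclusion γ ε₀ K ε n₀ Y F τ₁ μ₁) (hμ : 0 < μ₁)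
    (hY' : ∀ i k t, Y' i k t = μ₁⁻¹ * Y i (k + 1) (τ₁ + θ * t))
    (hF' : ∀ k t, F' k t = (μ₁ ^ 2)⁻¹ * F (k + 1) (τ₁ + θ * t)) :
    Y' 0 0 0 = 1 ∧ |Y' 1 0 0| ≤ 1 / 10 ^ 5 * ε ∧ |Y' 2 0 0| ≤ γ * ε ^ 2 ∧
      -(1 + ε₀) ^ (-(n₀ : ℝ) / 4) ≤ Y' 2 0 0 ∧ |Y' 3 0 0| ≤ (K ^ 10)⁻¹ ∧
      F' (-1) 0 ≤ (K ^ 20)⁻¹ ∧ 1 / 10 ^ 5 * ε ≤ Y' 1 (-1) 0 ∧ Y' 1 (-1) 0 ≤ 10 ^ 5 * ε ∧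
      Real.exp (K ^ 9) * ε ^ 2 ≤ Y' 2 (-1) 0 ∧ Y' 2 (-1) 0 ≤ Real.exp (K ^ 10) * ε ^ 2 := by
  have hμ0 : μ₁ ≠ 0 := hμ.ne'
  have hi : 0 < μ₁⁻¹ := inv_pos.mpr hμ
  simp only [hY', hF', mul_zero, add_zero, zero_add, show (-1 : ℤ) + 1 = 0 by norm_num]
  refine ⟨?_, ?_, ?_, ?_, ?_, ?_, ?_, ?_, ?_, ?_⟩
  · rw [hc.a_eq, inv_mul_cancel₀ hμ0]
  · rw [abs_mul, abs_of_pos hi]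
    calc μ₁⁻¹ * |Y 1 1 τ₁| ≤ μ₁⁻¹ * (1 / 10 ^ 5 * ε * μ₁) := by gcongr; exact hc.b_abs_le
      _ = 1 / 10 ^ 5 * ε := by field_simp
  · rw [abs_mul, abs_of_pos hi]
    calc μ₁⁻¹ * |Y 2 1 τ₁| ≤ μ₁⁻¹ * (γ * ε ^ 2 * μ₁) := by gcongr; exact hc.c_abs_le
      _ = γ * ε ^ 2 := by field_simp
  · have h1 := hc.c_ge
    calc -(1 + ε₀) ^ (-(n₀ : ℝ) / 4) = μ₁⁻¹ * (-((1 + ε₀) ^ (-(n₀ : ℝ) / 4) * μ₁)) := by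
          field_simp
      _ ≤ μ₁⁻¹ * Y 2 1 τ₁ := by gcongr
  · rw [abs_mul, abs_of_pos hi]
    calc μ₁⁻¹ * |Y 3 1 τ₁| ≤ μ₁⁻¹ * ((K ^ 10)⁻¹ * μ₁) := by gcongr; exact hc.d_abs_le
      _ = (K ^ 10)⁻¹ := by field_simp
  · calc (μ₁ ^ 2)⁻¹ * F 0 τ₁ ≤ (μ₁ ^ 2)⁻¹ * ((K ^ 20)⁻¹ * μ₁ ^ 2) := by
          gcongr; exact hc.energy_le
      _ = (K ^ 20)⁻¹ := by field_simp
  · calc 1 / 10 ^ 5 * ε = μ₁⁻¹ * (1 / 10 ^ 5 * ε * μ₁) := by field_simp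
      _ ≤ μ₁⁻¹ * Y 1 0 τ₁ := by gcongr; exact hc.b_prev_ge
  · calc μ₁⁻¹ * Y 1 0 τ₁ ≤ μ₁⁻¹ * (10 ^ 5 * ε * μ₁) := by gcongr; exact hc.b_prev_le
      _ = 10 ^ 5 * ε := by field_simp
  · calc Real.exp (K ^ 9) * ε ^ 2 = μ₁⁻¹ * (Real.exp (K ^ 9) * ε ^ 2 * μ₁) := by field_simp
      _ ≤ μ₁⁻¹ * Y 2 0 τ₁ := by gcongr; exact hc.c_prev_ge
  · calc μ₁⁻¹ * Y 2 0 τ₁ ≤ μ₁⁻¹ * (Real.exp (K ^ 10) * ε ^ 2 * μ₁) := by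
          gcongr; exact hc.c_prev_le
      _ = Real.exp (K ^ 10) * ε ^ 2 := by field_simp

/-! ### The energy estimates (ix) at level `N+1` -/

/-- `|k - 1| = |k| + 1` for `k ≤ 0` (real casts). [folklore] -/
theorem abs_intCast_sub_one {k : ℤ} (hk : k ≤ 0) : |(k : ℝ) - 1| = |(k : ℝ)| + 1 := by
  have hk' : (k : ℝ) ≤ 0 := by exact_mod_cast hk
  rw [abs_of_nonpos hk', abs_of_nonpos (by linarith)]
  ring

/-- (6.64) at level `N+1`. [cite: Tao2016AveragedNS, §6.4 Prop. 6.5 (6.64), (6.79)] -/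
theorem succ_en_before (hε₀ : 0 < ε₀) (hK : 0 < K)
    (h : RescaledHypotheses γ ε₀ K ε C₁ C₂ C₃ n₀ N τ Y F)
    (hc : RescaledConclusion γ ε₀ K ε n₀ Y F τ₁ μ₁) (hθp : 0 < θ)
    (hτ' : ∀ k, τ' k = (Function.update τ 1 τ₁ (k + 1) - τ₁) / θ)
    (hF' : ∀ k t, F' k t = (μ₁ ^ 2)⁻¹ * F (k + 1) (τ₁ + θ * t)) (k : ℤ)
    (hk : n₀ - (N + 1) < k) (hk0 : k ≤ 0) (m : ℕ) (hm : 2 ≤ m) (t : ℝ)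
    (ht : t ∈ Icc (τ' (k - 1)) (τ' k)) :
    F' (k - m) t ≤ (K ^ 10)⁻¹ * (1 + ε₀) ^ ((m : ℝ) / 10 + |(k : ℝ) - 1| / 50) := by
  have hq : (0 : ℝ) < 1 + ε₀ := by linarith
  have hμ2 := inv_mu_sq_le hε₀ hc.mu_ge
  rw [hF', show k - (m : ℤ) + 1 = k + 1 - m by ring, abs_intCast_sub_one hk0]
  rcases eq_or_lt_of_le hk0 with rfl | hlt
  · have hs := mem_Icc_of_mem_Icc_zero hθp h.tau_zero hτ' ht
    have hold := hc.en_before m hm _ hs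
    rw [show (0 : ℤ) + 1 - (m : ℤ) = 1 - m by ring]
    calc (μ₁ ^ 2)⁻¹ * F (1 - m) (τ₁ + θ * t)
        ≤ (1 + ε₀) ^ ((1 : ℝ) / 50) * ((K ^ 10)⁻¹ * (1 + ε₀) ^ ((m : ℝ) / 10)) :=
          mul_le_mul_of_nonneg hμ2 hold (by positivity) (by positivity)
      _ = (K ^ 10)⁻¹ * (1 + ε₀) ^ ((m : ℝ) / 10 + |((0 : ℤ) : ℝ)| / 50 + 1 / 50) := by
          rw [Real.rpow_add hq]; push_cast; simp; ring
      _ = (K ^ 10)⁻¹ * (1 + ε₀) ^ ((m : ℝ) / 10 + (|((0 : ℤ) : ℝ)| + 1) / 50) := by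
          congr 2; ring
  · have hs := mem_Icc_of_mem_Icc_neg hθp hτ' (by omega) ht
    have hold := h.en_before (k + 1) (by omega) (by omega) m hm (τ₁ + θ * t)
      (by rwa [show k + 1 - 1 = k by ring])
    have hcast : |(((k + 1 : ℤ)) : ℝ) - 1| = |(k : ℝ)| := by push_cast; ring_nf
    rw [hcast] at hold
    calc (μ₁ ^ 2)⁻¹ * F (k + 1 - m) (τ₁ + θ * t)
        ≤ (1 + ε₀) ^ ((1 : ℝ) / 50) * ((K ^ 10)⁻¹ * (1 + ε₀) ^ ((m : ℝ) / 10 + |(k : ℝ)| / 50)) :=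
          mul_le_mul_of_nonneg hμ2 hold (by positivity) (by positivity)
      _ = (K ^ 10)⁻¹ * (1 + ε₀) ^ ((m : ℝ) / 10 + (|(k : ℝ)| + 1) / 50) := by
          rw [show (m : ℝ) / 10 + (|(k : ℝ)| + 1) / 50 = (m : ℝ) / 10 + |(k : ℝ)| / 50 + 1 / 50 by
            ring, Real.rpow_add hq _ (1 / 50)]
          ring

/-- (6.65) at level `N+1`. [cite: Tao2016AveragedNS, §6.4 Prop. 6.5 (6.65), (6.80)] -/
theorem succ_en_during (hε₀ : 0 < ε₀)
    (h : RescaledHypotheses γ ε₀ K ε C₁ C₂ C₃ n₀ N τ Y F)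
    (hc : RescaledConclusion γ ε₀ K ε n₀ Y F τ₁ μ₁) (hθp : 0 < θ)
    (hτ' : ∀ k, τ' k = (Function.update τ 1 τ₁ (k + 1) - τ₁) / θ)
    (hF' : ∀ k t, F' k t = (μ₁ ^ 2)⁻¹ * F (k + 1) (τ₁ + θ * t)) (k : ℤ)
    (hk : n₀ - (N + 1) < k) (hk0 : k ≤ 0) (t : ℝ) (ht : t ∈ Icc (τ' (k - 1)) (τ' k)) :
    F' (k - 1) t + F' k t ≤ (1 + ε₀) ^ (|(k : ℝ) - 1| / 50) := by
  have hq : (0 : ℝ) < 1 + ε₀ := by linarith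
  have hμ2 := inv_mu_sq_le hε₀ hc.mu_ge
  rw [hF', hF', show k - 1 + 1 = k + 1 - 1 by ring, abs_intCast_sub_one hk0, ← mul_add]
  rcases eq_or_lt_of_le hk0 with rfl | hlt
  · have hs := mem_Icc_of_mem_Icc_zero hθp h.tau_zero hτ' ht
    have hold := hc.en_during _ hs
    rw [show (0 : ℤ) + 1 - 1 = 0 by ring, show (0 : ℤ) + 1 = 1 by ring]
    calc (μ₁ ^ 2)⁻¹ * (F 0 (τ₁ + θ * t) + F 1 (τ₁ + θ * t))
        ≤ (1 + ε₀) ^ ((1 : ℝ) / 50) * 1 :=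
          mul_le_mul_of_nonneg hμ2 hold (by positivity) (by positivity)
      _ = (1 + ε₀) ^ ((|((0 : ℤ) : ℝ)| + 1) / 50) := by simp
  · have hs := mem_Icc_of_mem_Icc_neg hθp hτ' (by omega) ht
    have hold := h.en_during (k + 1) (by omega) (by omega) (τ₁ + θ * t)
      (by rwa [show k + 1 - 1 = k by ring])
    have hcast : |(((k + 1 : ℤ)) : ℝ) - 1| = |(k : ℝ)| := by push_cast; ring_nf
    rw [hcast] at hold
    calc (μ₁ ^ 2)⁻¹ * (F (k + 1 - 1) (τ₁ + θ * t) + F (k + 1) (τ₁ + θ * t))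
        ≤ (1 + ε₀) ^ ((1 : ℝ) / 50) * (1 + ε₀) ^ (|(k : ℝ)| / 50) :=
          mul_le_mul_of_nonneg hμ2 hold (by positivity) (by positivity)
      _ = (1 + ε₀) ^ ((|(k : ℝ)| + 1) / 50) := by
          rw [← Real.rpow_add hq]; congr 1; ring

/-- (6.66) at level `N+1`. [cite: Tao2016AveragedNS, §6.4 Prop. 6.5 (6.66), (6.81)] -/
theorem succ_en_after (hε₀ : 0 < ε₀) (hK : 0 < K)
    (h : RescaledHypotheses γ ε₀ K ε C₁ C₂ C₃ n₀ N τ Y F)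
    (hc : RescaledConclusion γ ε₀ K ε n₀ Y F τ₁ μ₁) (hθp : 0 < θ)
    (hτ' : ∀ k, τ' k = (Function.update τ 1 τ₁ (k + 1) - τ₁) / θ)
    (hF' : ∀ k t, F' k t = (μ₁ ^ 2)⁻¹ * F (k + 1) (τ₁ + θ * t)) (k : ℤ)
    (hk : n₀ - (N + 1) < k) (hk0 : k ≤ 0) (m : ℕ) (hm : 1 ≤ m) (t : ℝ)
    (ht : t ∈ Icc (τ' (k - 1)) (τ' k)) :
    F' (k + m) t ≤ (K ^ 30)⁻¹ * (1 + ε₀) ^ (-(10 : ℝ) * m + |(k : ℝ) - 1| / 50) := by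
  have hq : (0 : ℝ) < 1 + ε₀ := by linarith
  have hμ2 := inv_mu_sq_le hε₀ hc.mu_ge
  rw [hF', show k + (m : ℤ) + 1 = k + 1 + m by ring, abs_intCast_sub_one hk0]
  rcases eq_or_lt_of_le hk0 with rfl | hlt
  · have hs := mem_Icc_of_mem_Icc_zero hθp h.tau_zero hτ' ht
    have hold := hc.en_after m hm _ hs
    rw [show (0 : ℤ) + 1 + (m : ℤ) = 1 + m by ring]
    calc (μ₁ ^ 2)⁻¹ * F (1 + m) (τ₁ + θ * t)
        ≤ (1 + ε₀) ^ ((1 : ℝ) / 50) * ((K ^ 30)⁻¹ * (1 + ε₀) ^ (-(10 : ℝ) * m)) :=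
          mul_le_mul_of_nonneg hμ2 hold (by positivity) (by positivity)
      _ = (K ^ 30)⁻¹ * (1 + ε₀) ^ (-(10 : ℝ) * m + (|((0 : ℤ) : ℝ)| + 1) / 50) := by
          rw [show -(10 : ℝ) * m + (|((0 : ℤ) : ℝ)| + 1) / 50 = -(10 : ℝ) * m + 1 / 50 by simp,
            Real.rpow_add hq]
          ring
  · have hs := mem_Icc_of_mem_Icc_neg hθp hτ' (by omega) ht
    have hold := h.en_after (k + 1) (by omega) (by omega) m hm (τ₁ + θ * t)
      (by rwa [show k + 1 - 1 = k by ring])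
    have hcast : |(((k + 1 : ℤ)) : ℝ) - 1| = |(k : ℝ)| := by push_cast; ring_nf
    rw [hcast] at hold
    calc (μ₁ ^ 2)⁻¹ * F (k + 1 + m) (τ₁ + θ * t)
        ≤ (1 + ε₀) ^ ((1 : ℝ) / 50) *
            ((K ^ 30)⁻¹ * (1 + ε₀) ^ (-(10 : ℝ) * m + |(k : ℝ)| / 50)) :=
          mul_le_mul_of_nonneg hμ2 hold (by positivity) (by positivity)
      _ = (K ^ 30)⁻¹ * (1 + ε₀) ^ (-(10 : ℝ) * m + (|(k : ℝ)| + 1) / 50) := by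
          rw [show -(10 : ℝ) * m + (|(k : ℝ)| + 1) / 50 = -(10 : ℝ) * m + |(k : ℝ)| / 50 + 1 / 50 by
            ring, Real.rpow_add hq _ (1 / 50)]
          ring

/-! ### The equations of motion (ii) and the energy defect (iv) at level `N+1` -/

/-- The scalar step common to (6.45)–(6.48): an error bound `|X| ≤ C (w q²) S` at level `N`
becomes `μ₁⁻² r |X| ≤ C w (μ₁⁻¹ S)` at level `N+1` as soon as `μ₁⁻¹ r q² ≤ 1`.
[cite: Tao2016AveragedNS, §6.4 p. 59] -/
theorem err_transfer {X C w S μ r q2 : ℝ} (hμ : 0 < μ) (hr : 0 < r) (hq2 : 0 < q2)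
    (hscal : μ⁻¹ * r * q2 ≤ 1) (hold : |X| ≤ C * (w * q2) * S) :
    (μ ^ 2)⁻¹ * r * |X| ≤ C * w * (μ⁻¹ * S) := by
  have hA : 0 ≤ C * (w * q2) * S := (abs_nonneg _).trans hold
  have hB : C * w * (μ⁻¹ * S) = C * (w * q2) * S * μ⁻¹ * q2⁻¹ := by field_simp
  have hB0 : 0 ≤ C * w * (μ⁻¹ * S) := by rw [hB]; positivity
  calc (μ ^ 2)⁻¹ * r * |X| ≤ (μ ^ 2)⁻¹ * r * (C * (w * q2) * S) := by gcongr
    _ = C * w * (μ⁻¹ * S) * (μ⁻¹ * r * q2) := by rw [hB]; field_simp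
    _ ≤ C * w * (μ⁻¹ * S) * 1 := by gcongr
    _ = C * w * (μ⁻¹ * S) := mul_one _

/-- (6.45) at level `N+1`. [cite: Tao2016AveragedNS, §6.4 Prop. 6.5 (6.45)] -/
theorem succ_eq1 (hε₀ : 0 < ε₀) (hN : n₀ ≤ N)
    (h : RescaledHypotheses γ ε₀ K ε C₁ C₂ C₃ n₀ N τ Y F)
    (hc : RescaledConclusion γ ε₀ K ε n₀ Y F τ₁ μ₁)
    (hθ : θ = ((1 + ε₀) ^ ((5 : ℝ) / 2) * μ₁)⁻¹)
    (hτ' : ∀ k, τ' k = (Function.update τ 1 τ₁ (k + 1) - τ₁) / θ)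
    (hY' : ∀ i k t, Y' i k t = μ₁⁻¹ * Y i (k + 1) (τ₁ + θ * t))
    (hF' : ∀ k t, F' k t = (μ₁ ^ 2)⁻¹ * F (k + 1) (τ₁ + θ * t)) (k : ℤ) (t : ℝ)
    (ht : τ' (n₀ - (N + 1)) ≤ t) :
    |derivWithin (Y' 0 k) (Ici (τ' (n₀ - (N + 1)))) t - (1 + ε₀) ^ ((5 : ℝ) * k / 2) *
        (-(ε ^ 2)⁻¹ * Y' 2 k t * Y' 3 k t - ε * Y' 0 k t * Y' 1 k t -
          ε ^ 2 * Real.exp (-K ^ 10) * Y' 0 k t * Y' 2 k t + K * Y' 3 (k - 1) t ^ 2)| ≤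
      C₁ * (1 + ε₀) ^ ((2 : ℝ) * k - n₀ / 2) * Real.sqrt (F' k t) := by
  have hq : (0 : ℝ) < 1 + ε₀ := by linarith
  have hμ := hc.mu_pos (by linarith)
  have hθp := theta_pos hε₀ hμ hθ
  have hbase := base_eq hθp.ne' hN hτ'
  have hs : τ (n₀ - N) ≤ τ₁ + θ * t := (base_le_iff hθp hN hτ' t).1 ht
  have hfun : Y' 0 k = fun u => μ₁⁻¹ * Y 0 (k + 1) (τ₁ + θ * u) := funext (hY' 0 k)
  have hdiff : DifferentiableWithinAt ℝ (Y 0 (k + 1)) (Ici (τ (n₀ - N))) (τ₁ + θ * t) :=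
    ((h.contDiffOn_Y 0 (k + 1)).differentiableOn one_ne_zero) _ hs
  rw [hfun, derivWithin_const_mul_comp_affine hθp hbase ht hdiff]
  simp only [hY', hF']
  rw [show k - 1 + 1 = k + 1 - 1 by ring, sqrt_inv_sq_mul hμ, rpow_main_shift hε₀ k]
  have hold := h.eq1 (k + 1) _ hs
  rw [rpow_err_shift hε₀ k n₀] at hold
  set s := τ₁ + θ * t with hs_def
  set r := ((1 + ε₀) ^ ((5 : ℝ) / 2))⁻¹ with hr
  have hr0 : 0 < r := inv_pos.mpr (Real.rpow_pos_of_pos hq _)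
  have hθ' : μ₁⁻¹ * θ = μ₁⁻¹ * (r * μ₁⁻¹) := by rw [hθ, mul_inv]
  rw [hθ']
  set u := (1 + ε₀) ^ ((5 : ℝ) * ((k + 1 : ℤ) : ℝ) / 2) with hu
  set D := derivWithin (Y 0 (k + 1)) (Ici (τ (n₀ - N))) s with hD
  have key : μ₁⁻¹ * (r * μ₁⁻¹) * D - r * u *
      (-(ε ^ 2)⁻¹ * (μ₁⁻¹ * Y 2 (k + 1) s) * (μ₁⁻¹ * Y 3 (k + 1) s) -
        ε * (μ₁⁻¹ * Y 0 (k + 1) s) * (μ₁⁻¹ * Y 1 (k + 1) s) -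
        ε ^ 2 * Real.exp (-K ^ 10) * (μ₁⁻¹ * Y 0 (k + 1) s) * (μ₁⁻¹ * Y 2 (k + 1) s) +
        K * (μ₁⁻¹ * Y 3 (k + 1 - 1) s) ^ 2) =
      (μ₁ ^ 2)⁻¹ * r * (D - u * (-(ε ^ 2)⁻¹ * Y 2 (k + 1) s * Y 3 (k + 1) s -
        ε * Y 0 (k + 1) s * Y 1 (k + 1) s -
        ε ^ 2 * Real.exp (-K ^ 10) * Y 0 (k + 1) s * Y 2 (k + 1) s +
        K * Y 3 (k + 1 - 1) s ^ 2)) := by ring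
  rw [key, abs_mul, abs_of_pos (by positivity : 0 < (μ₁ ^ 2)⁻¹ * r)]
  exact err_transfer hμ hr0 (Real.rpow_pos_of_pos hq _)
    (inv_mu_mul_scale_le_one hε₀ hc.mu_ge) hold

/-- (6.46) at level `N+1`. [cite: Tao2016AveragedNS, §6.4 Prop. 6.5 (6.46)] -/
theorem succ_eq2 (hε₀ : 0 < ε₀) (hN : n₀ ≤ N)
    (h : RescaledHypotheses γ ε₀ K ε C₁ C₂ C₃ n₀ N τ Y F)
    (hc : RescaledConclusion γ ε₀ K ε n₀ Y F τ₁ μ₁)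
    (hθ : θ = ((1 + ε₀) ^ ((5 : ℝ) / 2) * μ₁)⁻¹)
    (hτ' : ∀ k, τ' k = (Function.update τ 1 τ₁ (k + 1) - τ₁) / θ)
    (hY' : ∀ i k t, Y' i k t = μ₁⁻¹ * Y i (k + 1) (τ₁ + θ * t))
    (hF' : ∀ k t, F' k t = (μ₁ ^ 2)⁻¹ * F (k + 1) (τ₁ + θ * t)) (k : ℤ) (t : ℝ)
    (ht : τ' (n₀ - (N + 1)) ≤ t) :
    |derivWithin (Y' 1 k) (Ici (τ' (n₀ - (N + 1)))) t - (1 + ε₀) ^ ((5 : ℝ) * k / 2) *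
        (ε * Y' 0 k t ^ 2 - ε⁻¹ * K ^ 10 * Y' 2 k t ^ 2)| ≤
      C₁ * (1 + ε₀) ^ ((2 : ℝ) * k - n₀ / 2) * Real.sqrt (F' k t) := by
  have hq : (0 : ℝ) < 1 + ε₀ := by linarith
  have hμ := hc.mu_pos (by linarith)
  have hθp := theta_pos hε₀ hμ hθ
  have hbase := base_eq hθp.ne' hN hτ'
  have hs : τ (n₀ - N) ≤ τ₁ + θ * t := (base_le_iff hθp hN hτ' t).1 ht
  have hfun : Y' 1 k = fun u => μ₁⁻¹ * Y 1 (k + 1) (τ₁ + θ * u) := funext (hY' 1 k)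
  have hdiff : DifferentiableWithinAt ℝ (Y 1 (k + 1)) (Ici (τ (n₀ - N))) (τ₁ + θ * t) :=
    ((h.contDiffOn_Y 1 (k + 1)).differentiableOn one_ne_zero) _ hs
  rw [hfun, derivWithin_const_mul_comp_affine hθp hbase ht hdiff]
  simp only [hY', hF']
  rw [sqrt_inv_sq_mul hμ, rpow_main_shift hε₀ k]
  have hold := h.eq2 (k + 1) _ hs
  rw [rpow_err_shift hε₀ k n₀] at hold
  set s := τ₁ + θ * t with hs_def
  set r := ((1 + ε₀) ^ ((5 : ℝ) / 2))⁻¹ with hr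
  have hr0 : 0 < r := inv_pos.mpr (Real.rpow_pos_of_pos hq _)
  have hθ' : μ₁⁻¹ * θ = μ₁⁻¹ * (r * μ₁⁻¹) := by rw [hθ, mul_inv]
  rw [hθ']
  set u := (1 + ε₀) ^ ((5 : ℝ) * ((k + 1 : ℤ) : ℝ) / 2) with hu
  set D := derivWithin (Y 1 (k + 1)) (Ici (τ (n₀ - N))) s with hD
  have key : μ₁⁻¹ * (r * μ₁⁻¹) * D - r * u *
      (ε * (μ₁⁻¹ * Y 0 (k + 1) s) ^ 2 - ε⁻¹ * K ^ 10 * (μ₁⁻¹ * Y 2 (k + 1) s) ^ 2) =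
      (μ₁ ^ 2)⁻¹ * r * (D - u * (ε * Y 0 (k + 1) s ^ 2 - ε⁻¹ * K ^ 10 * Y 2 (k + 1) s ^ 2)) := by
    ring
  rw [key, abs_mul, abs_of_pos (by positivity : 0 < (μ₁ ^ 2)⁻¹ * r)]
  exact err_transfer hμ hr0 (Real.rpow_pos_of_pos hq _)
    (inv_mu_mul_scale_le_one hε₀ hc.mu_ge) hold

/-- (6.47) at level `N+1`. [cite: Tao2016AveragedNS, §6.4 Prop. 6.5 (6.47)] -/
theorem succ_eq3 (hε₀ : 0 < ε₀) (hN : n₀ ≤ N)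
    (h : RescaledHypotheses γ ε₀ K ε C₁ C₂ C₃ n₀ N τ Y F)
    (hc : RescaledConclusion γ ε₀ K ε n₀ Y F τ₁ μ₁)
    (hθ : θ = ((1 + ε₀) ^ ((5 : ℝ) / 2) * μ₁)⁻¹)
    (hτ' : ∀ k, τ' k = (Function.update τ 1 τ₁ (k + 1) - τ₁) / θ)
    (hY' : ∀ i k t, Y' i k t = μ₁⁻¹ * Y i (k + 1) (τ₁ + θ * t))
    (hF' : ∀ k t, F' k t = (μ₁ ^ 2)⁻¹ * F (k + 1) (τ₁ + θ * t)) (k : ℤ) (t : ℝ)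
    (ht : τ' (n₀ - (N + 1)) ≤ t) :
    |derivWithin (Y' 2 k) (Ici (τ' (n₀ - (N + 1)))) t - (1 + ε₀) ^ ((5 : ℝ) * k / 2) *
        (ε ^ 2 * Real.exp (-K ^ 10) * Y' 0 k t ^ 2 + ε⁻¹ * K ^ 10 * Y' 1 k t * Y' 2 k t)| ≤
      C₁ * (1 + ε₀) ^ ((2 : ℝ) * k - n₀ / 2) * Real.sqrt (F' k t) := by
  have hq : (0 : ℝ) < 1 + ε₀ := by linarith
  have hμ := hc.mu_pos (by linarith)
  have hθp := theta_pos hε₀ hμ hθ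
  have hbase := base_eq hθp.ne' hN hτ'
  have hs : τ (n₀ - N) ≤ τ₁ + θ * t := (base_le_iff hθp hN hτ' t).1 ht
  have hfun : Y' 2 k = fun u => μ₁⁻¹ * Y 2 (k + 1) (τ₁ + θ * u) := funext (hY' 2 k)
  have hdiff : DifferentiableWithinAt ℝ (Y 2 (k + 1)) (Ici (τ (n₀ - N))) (τ₁ + θ * t) :=
    ((h.contDiffOn_Y 2 (k + 1)).differentiableOn one_ne_zero) _ hs
  rw [hfun, derivWithin_const_mul_comp_affine hθp hbase ht hdiff]
  simp only [hY', hF']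
  rw [sqrt_inv_sq_mul hμ, rpow_main_shift hε₀ k]
  have hold := h.eq3 (k + 1) _ hs
  rw [rpow_err_shift hε₀ k n₀] at hold
  set s := τ₁ + θ * t with hs_def
  set r := ((1 + ε₀) ^ ((5 : ℝ) / 2))⁻¹ with hr
  have hr0 : 0 < r := inv_pos.mpr (Real.rpow_pos_of_pos hq _)
  have hθ' : μ₁⁻¹ * θ = μ₁⁻¹ * (r * μ₁⁻¹) := by rw [hθ, mul_inv]
  rw [hθ']
  set u := (1 + ε₀) ^ ((5 : ℝ) * ((k + 1 : ℤ) : ℝ) / 2) with hu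
  set D := derivWithin (Y 2 (k + 1)) (Ici (τ (n₀ - N))) s with hD
  have key : μ₁⁻¹ * (r * μ₁⁻¹) * D - r * u *
      (ε ^ 2 * Real.exp (-K ^ 10) * (μ₁⁻¹ * Y 0 (k + 1) s) ^ 2 +
        ε⁻¹ * K ^ 10 * (μ₁⁻¹ * Y 1 (k + 1) s) * (μ₁⁻¹ * Y 2 (k + 1) s)) =
      (μ₁ ^ 2)⁻¹ * r * (D - u * (ε ^ 2 * Real.exp (-K ^ 10) * Y 0 (k + 1) s ^ 2 +
        ε⁻¹ * K ^ 10 * Y 1 (k + 1) s * Y 2 (k + 1) s)) := by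
    ring
  rw [key, abs_mul, abs_of_pos (by positivity : 0 < (μ₁ ^ 2)⁻¹ * r)]
  exact err_transfer hμ hr0 (Real.rpow_pos_of_pos hq _)
    (inv_mu_mul_scale_le_one hε₀ hc.mu_ge) hold

/-- (6.48) at level `N+1`. [cite: Tao2016AveragedNS, §6.4 Prop. 6.5 (6.48)] -/
theorem succ_eq4 (hε₀ : 0 < ε₀) (hN : n₀ ≤ N)
    (h : RescaledHypotheses γ ε₀ K ε C₁ C₂ C₃ n₀ N τ Y F)
    (hc : RescaledConclusion γ ε₀ K ε n₀ Y F τ₁ μ₁)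
    (hθ : θ = ((1 + ε₀) ^ ((5 : ℝ) / 2) * μ₁)⁻¹)
    (hτ' : ∀ k, τ' k = (Function.update τ 1 τ₁ (k + 1) - τ₁) / θ)
    (hY' : ∀ i k t, Y' i k t = μ₁⁻¹ * Y i (k + 1) (τ₁ + θ * t))
    (hF' : ∀ k t, F' k t = (μ₁ ^ 2)⁻¹ * F (k + 1) (τ₁ + θ * t)) (k : ℤ) (t : ℝ)
    (ht : τ' (n₀ - (N + 1)) ≤ t) :
    |derivWithin (Y' 3 k) (Ici (τ' (n₀ - (N + 1)))) t - (1 + ε₀) ^ ((5 : ℝ) * k / 2) *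
        ((ε ^ 2)⁻¹ * Y' 2 k t * Y' 0 k t -
          (1 + ε₀) ^ ((5 : ℝ) / 2) * K * Y' 3 k t * Y' 0 (k + 1) t)| ≤
      C₁ * (1 + ε₀) ^ ((2 : ℝ) * k - n₀ / 2) * Real.sqrt (F' k t) := by
  have hq : (0 : ℝ) < 1 + ε₀ := by linarith
  have hμ := hc.mu_pos (by linarith)
  have hθp := theta_pos hε₀ hμ hθ
  have hbase := base_eq hθp.ne' hN hτ'
  have hs : τ (n₀ - N) ≤ τ₁ + θ * t := (base_le_iff hθp hN hτ' t).1 ht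
  have hfun : Y' 3 k = fun u => μ₁⁻¹ * Y 3 (k + 1) (τ₁ + θ * u) := funext (hY' 3 k)
  have hdiff : DifferentiableWithinAt ℝ (Y 3 (k + 1)) (Ici (τ (n₀ - N))) (τ₁ + θ * t) :=
    ((h.contDiffOn_Y 3 (k + 1)).differentiableOn one_ne_zero) _ hs
  rw [hfun, derivWithin_const_mul_comp_affine hθp hbase ht hdiff]
  simp only [hY', hF']
  rw [sqrt_inv_sq_mul hμ, rpow_main_shift hε₀ k]
  have hold := h.eq4 (k + 1) _ hs
  rw [rpow_err_shift hε₀ k n₀] at hold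
  set s := τ₁ + θ * t with hs_def
  have hq5 : (1 + ε₀) ^ ((5 : ℝ) / 2) ≠ 0 := (Real.rpow_pos_of_pos hq _).ne'
  set r := ((1 + ε₀) ^ ((5 : ℝ) / 2))⁻¹ with hr
  have hr0 : 0 < r := inv_pos.mpr (Real.rpow_pos_of_pos hq _)
  have hθ' : μ₁⁻¹ * θ = μ₁⁻¹ * (r * μ₁⁻¹) := by rw [hθ, mul_inv]
  rw [hθ']
  set u := (1 + ε₀) ^ ((5 : ℝ) * ((k + 1 : ℤ) : ℝ) / 2) with hu
  set D := derivWithin (Y 3 (k + 1)) (Ici (τ (n₀ - N))) s with hD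
  have key : μ₁⁻¹ * (r * μ₁⁻¹) * D - r * u *
      ((ε ^ 2)⁻¹ * (μ₁⁻¹ * Y 2 (k + 1) s) * (μ₁⁻¹ * Y 0 (k + 1) s) -
        (1 + ε₀) ^ ((5 : ℝ) / 2) * K * (μ₁⁻¹ * Y 3 (k + 1) s) * (μ₁⁻¹ * Y 0 (k + 1 + 1) s)) =
      (μ₁ ^ 2)⁻¹ * r * (D - u * ((ε ^ 2)⁻¹ * Y 2 (k + 1) s * Y 0 (k + 1) s -
        (1 + ε₀) ^ ((5 : ℝ) / 2) * K * Y 3 (k + 1) s * Y 0 (k + 1 + 1) s)) := by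
    ring
  rw [key, abs_mul, abs_of_pos (by positivity : 0 < (μ₁ ^ 2)⁻¹ * r)]
  exact err_transfer hμ hr0 (Real.rpow_pos_of_pos hq _)
    (inv_mu_mul_scale_le_one hε₀ hc.mu_ge) hold

/-- (6.49) at level `N+1`. [cite: Tao2016AveragedNS, §6.4 Prop. 6.5 (6.49)] -/
theorem succ_energy (hε₀ : 0 < ε₀) (hN : n₀ ≤ N)
    (h : RescaledHypotheses γ ε₀ K ε C₁ C₂ C₃ n₀ N τ Y F)
    (hc : RescaledConclusion γ ε₀ K ε n₀ Y F τ₁ μ₁)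
    (hθ : θ = ((1 + ε₀) ^ ((5 : ℝ) / 2) * μ₁)⁻¹)
    (hτ' : ∀ k, τ' k = (Function.update τ 1 τ₁ (k + 1) - τ₁) / θ)
    (hY' : ∀ i k t, Y' i k t = μ₁⁻¹ * Y i (k + 1) (τ₁ + θ * t))
    (hF' : ∀ k t, F' k t = (μ₁ ^ 2)⁻¹ * F (k + 1) (τ₁ + θ * t)) (k : ℤ) (t : ℝ)
    (ht : τ' (n₀ - (N + 1)) ≤ t) :
    derivWithin (F' k) (Ici (τ' (n₀ - (N + 1)))) t ≤
      K * (1 + ε₀) ^ ((5 : ℝ) * k / 2) *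
        (Y' 3 (k - 1) t ^ 2 * Y' 0 k t -
          (1 + ε₀) ^ ((5 : ℝ) / 2) * Y' 3 k t ^ 2 * Y' 0 (k + 1) t) := by
  have hq : (0 : ℝ) < 1 + ε₀ := by linarith
  have hμ := hc.mu_pos (by linarith)
  have hθp := theta_pos hε₀ hμ hθ
  have hbase := base_eq hθp.ne' hN hτ'
  have hs : τ (n₀ - N) ≤ τ₁ + θ * t := (base_le_iff hθp hN hτ' t).1 ht
  have hfun : F' k = fun u => (μ₁ ^ 2)⁻¹ * F (k + 1) (τ₁ + θ * u) := funext (hF' k)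
  have hdiff : DifferentiableWithinAt ℝ (F (k + 1)) (Ici (τ (n₀ - N))) (τ₁ + θ * t) :=
    ((h.contDiffOn_F (k + 1)).differentiableOn one_ne_zero) _ hs
  rw [hfun, derivWithin_const_mul_comp_affine hθp hbase ht hdiff]
  simp only [hY']
  rw [show k - 1 + 1 = k + 1 - 1 by ring, rpow_main_shift hε₀ k]
  have hold := h.energy (k + 1) _ hs
  set s := τ₁ + θ * t with hs_def
  set r := ((1 + ε₀) ^ ((5 : ℝ) / 2))⁻¹ with hr
  have hr0 : 0 < r := inv_pos.mpr (Real.rpow_pos_of_pos hq _)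
  have hθ' : (μ₁ ^ 2)⁻¹ * θ = (μ₁ ^ 2)⁻¹ * (r * μ₁⁻¹) := by rw [hθ, mul_inv]
  rw [hθ']
  set u := (1 + ε₀) ^ ((5 : ℝ) * ((k + 1 : ℤ) : ℝ) / 2) with hu
  set D := derivWithin (F (k + 1)) (Ici (τ (n₀ - N))) s with hD
  have hpos : 0 ≤ (μ₁ ^ 2)⁻¹ * (r * μ₁⁻¹) := by positivity
  have := mul_le_mul_of_nonneg_left hold hpos
  have e1 : (μ₁ ^ 2)⁻¹ * (r * μ₁⁻¹) * (K * u *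
      (Y 3 (k + 1 - 1) s ^ 2 * Y 0 (k + 1) s -
        (1 + ε₀) ^ ((5 : ℝ) / 2) * Y 3 (k + 1) s ^ 2 * Y 0 (k + 1 + 1) s)) =
      K * (r * u) * ((μ₁⁻¹ * Y 3 (k + 1 - 1) s) ^ 2 * (μ₁⁻¹ * Y 0 (k + 1) s) -
        (1 + ε₀) ^ ((5 : ℝ) / 2) * (μ₁⁻¹ * Y 3 (k + 1) s) ^ 2 * (μ₁⁻¹ * Y 0 (k + 1 + 1) s)) := by
    ring
  rw [e1] at this
  exact this

/-- (6.51), lower bound, at level `N+1`. [cite: Tao2016AveragedNS, §6.4 Prop. 6.5 (6.51)] -/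
theorem succ_defect_lower (hε₀ : 0 < ε₀) (hN : n₀ ≤ N)
    (h : RescaledHypotheses γ ε₀ K ε C₁ C₂ C₃ n₀ N τ Y F)
    (hc : RescaledConclusion γ ε₀ K ε n₀ Y F τ₁ μ₁)
    (hθ : θ = ((1 + ε₀) ^ ((5 : ℝ) / 2) * μ₁)⁻¹)
    (hτ' : ∀ k, τ' k = (Function.update τ 1 τ₁ (k + 1) - τ₁) / θ)
    (hY' : ∀ i k t, Y' i k t = μ₁⁻¹ * Y i (k + 1) (τ₁ + θ * t))
    (hF' : ∀ k t, F' k t = (μ₁ ^ 2)⁻¹ * F (k + 1) (τ₁ + θ * t)) (k : ℤ) (t : ℝ)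
    (ht : τ' (n₀ - (N + 1)) ≤ t) : (1 / 2) * ∑ i, Y' i k t ^ 2 ≤ F' k t := by
  have hμ := hc.mu_pos (by linarith)
  have hθp := theta_pos hε₀ hμ hθ
  have hs : τ (n₀ - N) ≤ τ₁ + θ * t := (base_le_iff hθp hN hτ' t).1 ht
  have hold := h.defect_lower (k + 1) _ hs
  simp only [hY', hF', mul_pow, ← Finset.mul_sum, inv_pow]
  calc 1 / 2 * ((μ₁ ^ 2)⁻¹ * ∑ i, Y i (k + 1) (τ₁ + θ * t) ^ 2)
      = (μ₁ ^ 2)⁻¹ * (1 / 2 * ∑ i, Y i (k + 1) (τ₁ + θ * t) ^ 2) := by ring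
    _ ≤ (μ₁ ^ 2)⁻¹ * F (k + 1) (τ₁ + θ * t) := mul_le_mul_of_nonneg_left hold (by positivity)

/-- (6.51), upper bound, at level `N+1` (the constant `C₂` only improves).
[cite: Tao2016AveragedNS, §6.4 Prop. 6.5 (6.51), p. 59] -/
theorem succ_defect_upper (hε₀ : 0 < ε₀) (hN : n₀ ≤ N)
    (h : RescaledHypotheses γ ε₀ K ε C₁ C₂ C₃ n₀ N τ Y F)
    (hc : RescaledConclusion γ ε₀ K ε n₀ Y F τ₁ μ₁)
    (hθ : θ = ((1 + ε₀) ^ ((5 : ℝ) / 2) * μ₁)⁻¹)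
    (hτ' : ∀ k, τ' k = (Function.update τ 1 τ₁ (k + 1) - τ₁) / θ)
    (hY' : ∀ i k t, Y' i k t = μ₁⁻¹ * Y i (k + 1) (τ₁ + θ * t))
    (hF' : ∀ k t, F' k t = (μ₁ ^ 2)⁻¹ * F (k + 1) (τ₁ + θ * t)) (k : ℤ) (t : ℝ)
    (ht : τ' (n₀ - (N + 1)) ≤ t) :
    F' k t ≤ (1 / 2) * ∑ i, Y' i k t ^ 2 +
      C₂ * (1 + ε₀) ^ ((2 : ℝ) * k - n₀ / 2) * ∫ s in (τ' (n₀ - (N + 1)))..t, F' k s := by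
  have hq : (0 : ℝ) < 1 + ε₀ := by linarith
  have hμ := hc.mu_pos (by linarith)
  have hθp := theta_pos hε₀ hμ hθ
  have hbase := base_eq hθp.ne' hN hτ'
  have hs : τ (n₀ - N) ≤ τ₁ + θ * t := (base_le_iff hθp hN hτ' t).1 ht
  have hint : (∫ s in (τ' (n₀ - (N + 1)))..t, F' k s) =
      (μ₁ ^ 2)⁻¹ * θ⁻¹ * ∫ s in (τ (n₀ - N))..(τ₁ + θ * t), F (k + 1) s := by
    simp_rw [hF']
    rw [integral_const_mul_comp_affine _ hθp.ne', hbase]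
  rw [hint]
  simp only [hY', hF', mul_pow, ← Finset.mul_sum, inv_pow]
  have hold := h.defect_upper (k + 1) _ hs
  have hlow := h.defect_lower (k + 1) _ hs
  rw [rpow_err_shift hε₀ k n₀] at hold
  set s := τ₁ + θ * t with hs_def
  set I := ∫ s in (τ (n₀ - N))..s, F (k + 1) s with hI
  set w := (1 + ε₀) ^ ((2 : ℝ) * k - n₀ / 2) with hw
  set S := ∑ i, Y i (k + 1) s ^ 2 with hS
  have hCvI : 0 ≤ C₂ * (w * (1 + ε₀) ^ (2 : ℝ)) * I := by linarith
  have hscal : (1 + ε₀) ^ (2 : ℝ) ≤ θ⁻¹ := by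
    have h1 := scale_sq_mul_theta_le_one hε₀ hc.mu_ge
    rw [← hθ] at h1
    rwa [le_inv_comm₀ (Real.rpow_pos_of_pos hq _) hθp, ← one_div,
      le_div_iff₀ (Real.rpow_pos_of_pos hq _), mul_comm]
  have step1 : (μ₁ ^ 2)⁻¹ * F (k + 1) s ≤
      1 / 2 * ((μ₁ ^ 2)⁻¹ * S) + (μ₁ ^ 2)⁻¹ * (C₂ * (w * (1 + ε₀) ^ (2 : ℝ)) * I) := by
    have := mul_le_mul_of_nonneg_left hold (by positivity : 0 ≤ (μ₁ ^ 2)⁻¹)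
    have e : (μ₁ ^ 2)⁻¹ * (1 / 2 * S + C₂ * (w * (1 + ε₀) ^ (2 : ℝ)) * I) =
        1 / 2 * ((μ₁ ^ 2)⁻¹ * S) + (μ₁ ^ 2)⁻¹ * (C₂ * (w * (1 + ε₀) ^ (2 : ℝ)) * I) := by ring
    rwa [e] at this
  have step2 : (μ₁ ^ 2)⁻¹ * (C₂ * (w * (1 + ε₀) ^ (2 : ℝ)) * I) ≤
      C₂ * w * ((μ₁ ^ 2)⁻¹ * θ⁻¹ * I) := by
    have hq2 : (0 : ℝ) < (1 + ε₀) ^ (2 : ℝ) := Real.rpow_pos_of_pos hq _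
    have e : C₂ * w * ((μ₁ ^ 2)⁻¹ * θ⁻¹ * I) - (μ₁ ^ 2)⁻¹ * (C₂ * (w * (1 + ε₀) ^ (2 : ℝ)) * I) =
        C₂ * (w * (1 + ε₀) ^ (2 : ℝ)) * I * (μ₁ ^ 2)⁻¹ *
          ((θ⁻¹ - (1 + ε₀) ^ (2 : ℝ)) / (1 + ε₀) ^ (2 : ℝ)) := by
      field_simp
    have : 0 ≤ C₂ * (w * (1 + ε₀) ^ (2 : ℝ)) * I * (μ₁ ^ 2)⁻¹ *
        ((θ⁻¹ - (1 + ε₀) ^ (2 : ℝ)) / (1 + ε₀) ^ (2 : ℝ)) :=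
      mul_nonneg (mul_nonneg hCvI (by positivity))
        (div_nonneg (sub_nonneg.2 hscal) hq2.le)
    linarith
  linarith [step1, step2]

/-! ### The scale-evolution bound (6.53) at level `N+1`

(6.53) is not preserved step by step with the same implied constant; what is preserved is the
per-step lifespan bound `τ_k - τ_{k-1} ≤ L (1+ε₀)^{(5/2+1/100)|k-1|}` (the rescaled form of
(6.14), valid for `L = C₃` at the starting level and propagated by (6.67)–(6.68) as soon as
`L ≥ 100`), from which (6.53) follows with the constant `L (1+ε₀)^β/((1+ε₀)^β - 1)`,
`β = 5/2 + 1/100`, by summing the geometric series (as on p. 59). -/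

/-- The per-step lifespan bound propagates from level `N` to level `N+1` when `L ≥ 100`.
[cite: Tao2016AveragedNS, §6.4 Prop. 6.5 (6.67)–(6.68), p. 59] -/
theorem succ_lifespan (hε₀ : 0 < ε₀) {L : ℝ} (hL : 100 ≤ L)
    (h : RescaledHypotheses γ ε₀ K ε C₁ C₂ C₃ n₀ N τ Y F)
    (hc : RescaledConclusion γ ε₀ K ε n₀ Y F τ₁ μ₁)
    (hθ : θ = ((1 + ε₀) ^ ((5 : ℝ) / 2) * μ₁)⁻¹)
    (hτ' : ∀ k, τ' k = (Function.update τ 1 τ₁ (k + 1) - τ₁) / θ)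
    (hlife : ∀ k, n₀ - N < k → k ≤ 0 →
      τ k - τ (k - 1) ≤ L * (1 + ε₀) ^ (((5 : ℝ) / 2 + 1 / 100) * |(k : ℝ) - 1|))
    (k : ℤ) (hk : n₀ - (N + 1) < k) (hk0 : k ≤ 0) :
    τ' k - τ' (k - 1) ≤ L * (1 + ε₀) ^ (((5 : ℝ) / 2 + 1 / 100) * |(k : ℝ) - 1|) := by
  have hq : (0 : ℝ) < 1 + ε₀ := by linarith
  have hμ := hc.mu_pos (by linarith)
  have hθp := theta_pos hε₀ hμ hθ
  -- `θ⁻¹ ≤ (1+ε₀)^β`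
  have hθinv : θ⁻¹ ≤ (1 + ε₀) ^ ((5 : ℝ) / 2 + 1 / 100) := by
    rw [hθ, inv_inv, Real.rpow_add hq]
    exact mul_le_mul_of_nonneg_left hc.mu_le (Real.rpow_pos_of_pos hq _).le
  rcases eq_or_lt_of_le hk0 with rfl | hlt
  · rw [tau'_zero hτ', tau'_of_ne hτ' (by omega), show (0 : ℤ) - 1 + 1 = 0 by ring, h.tau_zero]
    have e : (0 : ℝ) - (0 - τ₁) / θ = τ₁ * θ⁻¹ := by field_simp; ring
    rw [e, show |((0 : ℤ) : ℝ) - 1| = 1 by simp, mul_one]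
    calc τ₁ * θ⁻¹ ≤ 100 * (1 + ε₀) ^ ((5 : ℝ) / 2 + 1 / 100) :=
          mul_le_mul hc.tau_le hθinv (inv_pos.mpr hθp).le (by norm_num)
      _ ≤ L * (1 + ε₀) ^ ((5 : ℝ) / 2 + 1 / 100) := by gcongr
  · rw [tau'_of_ne hτ' (by omega), tau'_of_ne hτ' (by omega), show k - 1 + 1 = k by ring]
    have hold := hlife (k + 1) (by omega) (by omega)
    rw [show k + 1 - 1 = k by ring] at hold
    have hcast : |(((k + 1 : ℤ)) : ℝ) - 1| = |(k : ℝ)| := by push_cast; ring_nf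
    rw [hcast] at hold
    rw [abs_intCast_sub_one hk0, mul_add, mul_one, Real.rpow_add hq]
    have e : (τ (k + 1) - τ₁) / θ - (τ k - τ₁) / θ = (τ (k + 1) - τ k) * θ⁻¹ := by
      field_simp; ring
    rw [e]
    have hL0 : 0 ≤ L * (1 + ε₀) ^ (((5 : ℝ) / 2 + 1 / 100) * |(k : ℝ)|) := by
      have : (0 : ℝ) ≤ 100 := by norm_num
      exact mul_nonneg (this.trans hL) (Real.rpow_pos_of_pos hq _).le
    calc (τ (k + 1) - τ k) * θ⁻¹
        ≤ L * (1 + ε₀) ^ (((5 : ℝ) / 2 + 1 / 100) * |(k : ℝ)|) * θ⁻¹ :=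
          mul_le_mul_of_nonneg_right hold (inv_pos.mpr hθp).le
      _ ≤ L * (1 + ε₀) ^ (((5 : ℝ) / 2 + 1 / 100) * |(k : ℝ)|) *
            (1 + ε₀) ^ ((5 : ℝ) / 2 + 1 / 100) := mul_le_mul_of_nonneg_left hθinv hL0
      _ = L * ((1 + ε₀) ^ (((5 : ℝ) / 2 + 1 / 100) * |(k : ℝ)|) *
            (1 + ε₀) ^ ((5 : ℝ) / 2 + 1 / 100)) := by ring

/-- Summing the geometric series: the per-step lifespan bound with constant `L ≥ 0` gives the
scale-evolution bound (6.53) with constant `L (1+ε₀)^β/((1+ε₀)^β - 1)`, `β = 5/2 + 1/100`.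
[cite: Tao2016AveragedNS, §6.4 p. 59] -/
theorem tau_ge_of_lifespan (hε₀ : 0 < ε₀) {L : ℝ} (hL : 0 ≤ L) {n₀ N : ℤ} {σ : ℤ → ℝ}
    (h0 : σ 0 = 0)
    (hlife : ∀ k, n₀ - N < k → k ≤ 0 →
      σ k - σ (k - 1) ≤ L * (1 + ε₀) ^ (((5 : ℝ) / 2 + 1 / 100) * |(k : ℝ) - 1|))
    (k : ℤ) (hk : n₀ - N ≤ k) (hk0 : k ≤ 0) :
    -(L * ((1 + ε₀) ^ ((5 : ℝ) / 2 + 1 / 100) / ((1 + ε₀) ^ ((5 : ℝ) / 2 + 1 / 100) - 1)) *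
        (1 + ε₀) ^ (((5 : ℝ) / 2 + 1 / 100) * |(k : ℝ)|)) ≤ σ k := by
  have hq : (0 : ℝ) < 1 + ε₀ := by linarith
  have hq1 : (1 : ℝ) < 1 + ε₀ := by linarith
  set β : ℝ := (5 : ℝ) / 2 + 1 / 100 with hβ
  set Q : ℝ := (1 + ε₀) ^ β with hQ
  have hQ1 : 1 < Q := Real.one_lt_rpow hq1 (by norm_num)
  have hQpos : 0 < Q := by linarith
  have hQm : ∀ m : ℕ, (1 + ε₀) ^ (β * m) = Q ^ m := by
    intro m; rw [Real.rpow_mul hq.le, Real.rpow_natCast]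
  -- induction on `m = -k`
  have main : ∀ m : ℕ, n₀ - N ≤ -(m : ℤ) →
      -(L * (Q * (Q ^ m - 1) / (Q - 1))) ≤ σ (-(m : ℤ)) := by
    intro m
    induction m with
    | zero => intro _; simp [h0]
    | succ m ih =>
      intro hm
      have ih' := ih (by omega)
      have hstep := hlife (-(m : ℤ)) (by omega) (by omega)
      have hcast : |((-(m : ℤ) : ℤ) : ℝ) - 1| = (m + 1 : ℕ) := by
        have hm0 : (0 : ℝ) ≤ m := Nat.cast_nonneg m
        push_cast
        rw [abs_of_nonpos (by linarith)]
        ring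
      rw [hcast, hQm] at hstep
      have e1 : (-((m + 1 : ℕ) : ℤ)) = -(m : ℤ) - 1 := by push_cast; ring
      rw [e1]
      have e2 : L * (Q * (Q ^ (m + 1) - 1) / (Q - 1)) =
          L * (Q * (Q ^ m - 1) / (Q - 1)) + L * Q ^ (m + 1) := by
        have : Q - 1 ≠ 0 := by linarith
        field_simp
        ring
      rw [e2]
      linarith
  obtain ⟨m, rfl⟩ : ∃ m : ℕ, k = -(m : ℤ) := ⟨(-k).toNat, by omega⟩
  have hmain := main m hk
  have hcast : |((-(m : ℤ) : ℤ) : ℝ)| = m := by push_cast; simp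
  rw [hcast, hQm]
  have hle : L * (Q * (Q ^ m - 1) / (Q - 1)) ≤ L * (Q / (Q - 1)) * Q ^ m := by
    have : Q - 1 ≠ 0 := by linarith
    rw [show L * (Q / (Q - 1)) * Q ^ m = L * (Q * Q ^ m / (Q - 1)) by field_simp]
    have hQ1' : 0 ≤ Q - 1 := by linarith
    apply mul_le_mul_of_nonneg_left _ hL
    apply div_le_div_of_nonneg_right _ hQ1'
    nlinarith
  linarith

end Succ

end RescaledShift

/-! ## The step and its monotonicity, assembled -/

section Step

open RescaledShift

variable {γ ε₀ K ε C₁ C₂ C₃ : ℝ} {n₀ N : ℤ} {τ : ℤ → ℝ} {Y : Fin 4 → ℤ → ℝ → ℝ} {F : ℤ → ℝ → ℝ}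
  {τ₁ μ₁ θ : ℝ} {τ' : ℤ → ℝ} {Y' : Fin 4 → ℤ → ℝ → ℝ} {F' : ℤ → ℝ → ℝ}

/-- The per-step lifespan bound holds at the starting level with `L = C₃`.
[cite: Tao2016AveragedNS, §6.4 Prop. 6.5 (6.53)] -/
theorem RescaledHypotheses.lifespan
    (h : RescaledHypotheses γ ε₀ K ε C₁ C₂ C₃ n₀ N τ Y F) (k : ℤ) (hk : n₀ - N < k)
    (hk0 : k ≤ 0) :
    τ k - τ (k - 1) ≤ C₃ * (1 + ε₀) ^ (((5 : ℝ) / 2 + 1 / 100) * |(k : ℝ) - 1|) := by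
  have h1 := h.tau_le k (by omega) hk0
  have h2 := h.tau_ge (k - 1) (by omega) (by omega)
  push_cast at h2
  linarith

/-! ### Monotonicity in the constants -/

/-- The hypotheses of Prop. 6.5 are monotone in the `X₃`-coefficient `γ` of (6.56) and in the
implied constant `C₃` of (6.53). [cite: Tao2016AveragedNS, §6.4 Prop. 6.5 (6.53), (6.56)] -/
theorem RescaledHypotheses.mono {γ' C₃' : ℝ} (hε₀ : 0 < ε₀)
    (h : RescaledHypotheses γ ε₀ K ε C₁ C₂ C₃ n₀ N τ Y F) (hγ : γ ≤ γ') (hC : C₃ ≤ C₃') :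
    RescaledHypotheses γ' ε₀ K ε C₁ C₂ C₃' n₀ N τ Y F :=
  { h with
    c_abs_le := h.c_abs_le.trans (by gcongr)
    tau_ge := fun k hk hk0 => by
      have hq : (0 : ℝ) < 1 + ε₀ := by linarith
      have h1 := h.tau_ge k hk hk0
      have : C₃ * (1 + ε₀) ^ (((5 : ℝ) / 2 + 1 / 100) * |(k : ℝ)|) ≤
          C₃' * (1 + ε₀) ^ (((5 : ℝ) / 2 + 1 / 100) * |(k : ℝ)|) :=
        mul_le_mul_of_nonneg_right hC (Real.rpow_pos_of_pos hq _).le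
      linarith }

/-! ### Assembly of the step -/

/-- **One rescaling step** (the rescaling (6.82)–(6.83) of Tao's §6.4 performed from level `N`
to level `N+1`): data obeying the hypotheses (i)–(ix) of Prop. 6.5 at level `N` together with the
per-step lifespan bound with constant `L ≥ 100`, and a pair `(τ₁, μ₁)` obeying the conclusion
(6.67)–(6.81), yield — after rescaling time by `θ = ((1+ε₀)^{5/2} μ₁)⁻¹` around `τ₁`,
amplitudes by `μ₁` and shifting scales by one — data obeying the hypotheses at level `N+1` with
the same `γ, C₁, C₂`, any `C₃' ≥ L (1+ε₀)^β/((1+ε₀)^β-1)`, and the same lifespan constant `L`.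
[cite: Tao2016AveragedNS, §6.4 Prop. 6.5, (6.82)–(6.84), p. 59] -/
theorem RescaledHypotheses.succ {L C₃' : ℝ} (hε₀ : 0 < ε₀) (hK : 0 < K)
    (hN : n₀ ≤ N) (h : RescaledHypotheses γ ε₀ K ε C₁ C₂ C₃ n₀ N τ Y F)
    (hc : RescaledConclusion γ ε₀ K ε n₀ Y F τ₁ μ₁)
    (hθ : θ = ((1 + ε₀) ^ ((5 : ℝ) / 2) * μ₁)⁻¹)
    (hτ' : ∀ k, τ' k = (Function.update τ 1 τ₁ (k + 1) - τ₁) / θ)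
    (hY' : ∀ i k t, Y' i k t = μ₁⁻¹ * Y i (k + 1) (τ₁ + θ * t))
    (hF' : ∀ k t, F' k t = (μ₁ ^ 2)⁻¹ * F (k + 1) (τ₁ + θ * t))
    (hL : 100 ≤ L)
    (hlife : ∀ k, n₀ - N < k → k ≤ 0 →
      τ k - τ (k - 1) ≤ L * (1 + ε₀) ^ (((5 : ℝ) / 2 + 1 / 100) * |(k : ℝ) - 1|))
    (hC : L * ((1 + ε₀) ^ ((5 : ℝ) / 2 + 1 / 100) / ((1 + ε₀) ^ ((5 : ℝ) / 2 + 1 / 100) - 1))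
      ≤ C₃') :
    RescaledHypotheses γ ε₀ K ε C₁ C₂ C₃' n₀ (N + 1) τ' Y' F' ∧
      ∀ k, n₀ - (N + 1) < k → k ≤ 0 →
        τ' k - τ' (k - 1) ≤ L * (1 + ε₀) ^ (((5 : ℝ) / 2 + 1 / 100) * |(k : ℝ) - 1|) := by
  have hq : (0 : ℝ) < 1 + ε₀ := by linarith
  have hμ := hc.mu_pos (by linarith)
  have hθp := theta_pos hε₀ hμ hθ
  have hτ₁ : 0 < τ₁ := by linarith [hc.tau_ge]
  have hlife' := succ_lifespan hε₀ hL h hc hθ hτ' hlife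
  have hL0 : 0 ≤ L := le_trans (by norm_num) hL
  obtain ⟨s1, s2, s3, s4, s5, s6, s7, s8, s9, s10⟩ := succ_state hc hμ hY' hF'
  refine ⟨?_, hlife'⟩
  exact {
    tau_zero := tau'_zero hτ'
    tau_lt := succ_tau_lt h hθp hτ₁ hτ'
    contDiffOn_Y := succ_contDiffOn_Y hε₀ hN h hμ hθ hτ' hY'
    contDiffOn_F := succ_contDiffOn_F hε₀ hN h hμ hθ hτ' hF'
    nonneg_F := succ_nonneg_F hε₀ hN h hμ hθ hτ' hF'
    apriori_Y := succ_apriori_Y hε₀ hN h hμ hθ hτ' hY'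
    apriori_F := succ_apriori_F hε₀ hN h hμ hθ hτ' hF'
    eq1 := succ_eq1 hε₀ hN h hc hθ hτ' hY' hF'
    eq2 := succ_eq2 hε₀ hN h hc hθ hτ' hY' hF'
    eq3 := succ_eq3 hε₀ hN h hc hθ hτ' hY' hF'
    eq4 := succ_eq4 hε₀ hN h hc hθ hτ' hY' hF'
    energy := succ_energy hε₀ hN h hc hθ hτ' hY' hF'
    init_Y := succ_init_Y hε₀ hN h hμ hθ hτ' hY'
    init_F := succ_init_F hε₀ hN h hμ hθ hτ' hF'
    defect_lower := succ_defect_lower hε₀ hN h hc hθ hτ' hY' hF'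
    defect_upper := succ_defect_upper hε₀ hN h hc hθ hτ' hY' hF'
    noLow_Y := succ_noLow_Y hε₀ hN h hμ hθ hτ' hY'
    noLow_F := succ_noLow_F hε₀ hN h hμ hθ hτ' hF'
    tau_ge := fun k hk hk0 =>
      le_trans (by
        have hX : 0 ≤ (1 + ε₀) ^ (((5 : ℝ) / 2 + 1 / 100) * |(k : ℝ)|) :=
          (Real.rpow_pos_of_pos hq _).le
        have := mul_le_mul_of_nonneg_right hC hX
        linarith) (tau_ge_of_lifespan hε₀ hL0 (tau'_zero hτ') hlife' k hk hk0)
    tau_le := succ_tau_le h hθp hτ₁ hτ'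
    a_eq := s1
    b_abs_le := s2
    c_abs_le := s3
    c_ge := s4
    d_abs_le := s5
    energy_prev_le := s6
    b_prev_ge := fun _ => s7
    b_prev_le := fun _ => s8
    c_prev_ge := fun _ => s9
    c_prev_le := fun _ => s10
    en_before := fun k hk hk0 m hm t ht => succ_en_before hε₀ hK h hc hθp hτ' hF' k hk hk0 m hm t ht
    en_during := fun k hk hk0 t ht => succ_en_during hε₀ h hc hθp hτ' hF' k hk hk0 t ht
    en_after := fun k hk hk0 m hm t ht => succ_en_after hε₀ hK h hc hθp hτ' hF' k hk hk0 m hm t ht }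

end Step

open RescaledShift

/-! ## Iterating the step: the hypotheses of Prop. 6.5 are self-refuting

If `rescaledStepWith γ` holds then, in its own parameter regime (with the implied constant of
(6.53) enlarged to absorb the geometric series), no data can satisfy `RescaledHypotheses (γ K)`:
iterating the step produces checkpoint times `T_j` (in the time units of the starting level)
bounded by a geometric series and amplitudes `M_j ≥ (1+ε₀)^{-j/100}` with `a_j(T_j) = M_j`, so
`(1 + (1+ε₀)^{10j}) |a_j(T_j)| ≥ (1+ε₀)^{(10 - 1/100) j} → ∞` on a bounded time interval,
contradicting the a priori regularity (6.43). This is the argument of §6.2 (p. 53, "Let us now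
see how the above proposition implies Theorem 6.2") run in rescaled coordinates. -/

/-- Bounding a geometric sum with ratio in `[0,1)`. [folklore] -/
theorem geom_sum_le_inv_one_sub {ρ : ℝ} (h0 : 0 ≤ ρ) (h1 : ρ < 1) (j : ℕ) :
    ∑ i ∈ Finset.range j, ρ ^ i ≤ 1 / (1 - ρ) := by
  have h := geom_sum_mul_neg ρ j
  rw [le_div_iff₀ (by linarith), h]
  linarith [pow_nonneg h0 j]

/-- **The hypotheses of Prop. 6.5 refute themselves under Prop. 6.5** (Tao's §6.2 blow-up
argument, p. 53, in the rescaled coordinates of §6.4): if `rescaledStepWith γ` holds, then for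
`0 < ε₀ < 1`, `K ≥ K₀(ε₀)`, `0 < ε ≤ e₀(ε₀, K)`, implied constants `C₁, C₂, C₃ ≥ 0` and
`n₀ ≥ N₀(ε₀, K, ε, C₁, C₂, C₃)`, no rescaled times / modes / energies obey (i)–(ix) of Prop. 6.5
at any level `N ≥ n₀`. [cite: Tao2016AveragedNS, §6.2 p. 53, §6.4 Prop. 6.5 and p. 59] -/
theorem not_rescaledHypotheses_of_rescaledStepWith {γ : ℝ → ℝ} (h65 : rescaledStepWith γ) :
    ∀ ε₀ : ℝ, 0 < ε₀ → ε₀ < 1 →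
      ∃ K₀ : ℝ, ∀ K : ℝ, K₀ ≤ K → 0 < K →
        ∃ e₀ : ℝ, 0 < e₀ ∧ ∀ ε : ℝ, 0 < ε → ε ≤ e₀ →
          ∀ C₁ C₂ C₃ : ℝ, 0 ≤ C₁ → 0 ≤ C₂ → 0 ≤ C₃ →
            ∃ N₀ : ℤ, ∀ n₀ : ℤ, N₀ ≤ n₀ → ∀ N : ℤ, n₀ ≤ N →
              ∀ (τ : ℤ → ℝ) (Y : Fin 4 → ℤ → ℝ → ℝ) (F : ℤ → ℝ → ℝ),
                ¬ RescaledHypotheses (γ K) ε₀ K ε C₁ C₂ C₃ n₀ N τ Y F := by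
  intro ε₀ hε₀ hε₀1
  obtain ⟨K₀, hK⟩ := h65 ε₀ hε₀ hε₀1
  refine ⟨K₀, fun K hK₀K hKpos => ?_⟩
  obtain ⟨e₀, he₀, hε⟩ := hK K hK₀K hKpos
  refine ⟨e₀, he₀, fun ε hεpos hεle C₁ C₂ C₃ hC₁ hC₂ hC₃ => ?_⟩
  have hq : (0 : ℝ) < 1 + ε₀ := by linarith
  have hq1 : (1 : ℝ) < 1 + ε₀ := by linarith
  -- the enlarged constant of (6.53)
  set Q : ℝ := (1 + ε₀) ^ ((5 : ℝ) / 2 + 1 / 100) with hQ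
  have hQ1 : 1 < Q := Real.one_lt_rpow hq1 (by norm_num)
  set L : ℝ := max C₃ 100 with hL
  set C₃' : ℝ := L * (Q / (Q - 1)) with hC₃'
  have hL100 : 100 ≤ L := le_max_right _ _
  have hL0 : 0 ≤ L := le_trans (by norm_num) hL100
  have hQQ : 1 ≤ Q / (Q - 1) := by rw [le_div_iff₀ (by linarith)]; linarith
  have hC₃L : C₃ ≤ C₃' := (le_max_left _ _).trans (le_mul_of_one_le_right hL0 hQQ)
  have hC₃'0 : 0 ≤ C₃' := hC₃.trans hC₃L
  obtain ⟨N₀, hN₀⟩ := hε ε hεpos hεle C₁ C₂ C₃' hC₁ hC₂ hC₃'0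
  refine ⟨N₀, fun n₀ hn₀ N hN τ Y F hyp => ?_⟩
  -- the contraction ratio of the lifespans
  set ρ : ℝ := (1 + ε₀) ^ (-(5 : ℝ) / 2 + 1 / 100) with hρ
  have hρpos : 0 < ρ := Real.rpow_pos_of_pos hq _
  have hρ1 : ρ < 1 := Real.rpow_lt_one_of_one_lt_of_neg hq1 (by norm_num)
  -- the invariant after `j` steps
  have hP : ∀ j : ℕ, ∃ (T M Θ : ℝ) (σ : ℤ → ℝ) (Yj : Fin 4 → ℤ → ℝ → ℝ) (Fj : ℤ → ℝ → ℝ),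
      (∀ i k t, Yj i k t = M⁻¹ * Y i (k + j) (T + Θ * t)) ∧
      (∀ k t, Fj k t = (M ^ 2)⁻¹ * F (k + j) (T + Θ * t)) ∧
      0 ≤ T ∧ T ≤ 100 * ∑ i ∈ Finset.range j, ρ ^ i ∧ 0 < M ∧
      (1 + ε₀) ^ (-(j : ℝ) / 100) ≤ M ∧ 0 < Θ ∧ Θ ≤ ρ ^ j ∧
      RescaledHypotheses (γ K) ε₀ K ε C₁ C₂ C₃' n₀ (N + j) σ Yj Fj ∧
      (∀ k, n₀ - (N + j) < k → k ≤ 0 →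
        σ k - σ (k - 1) ≤ L * (1 + ε₀) ^ (((5 : ℝ) / 2 + 1 / 100) * |(k : ℝ) - 1|)) := by
    intro j
    induction j with
    | zero =>
      refine ⟨0, 1, 1, τ, Y, F, ?_, ?_, le_rfl, by simp, one_pos, by simp, one_pos, by simp,
        ?_, ?_⟩
      · intro i k t; simp
      · intro k t; simp
      · simpa using hyp.mono hε₀ le_rfl hC₃L
      · intro k hk hk0
        have h1 := hyp.lifespan k (by simpa using hk) hk0
        exact h1.trans (mul_le_mul_of_nonneg_right (le_max_left _ _)
          (Real.rpow_pos_of_pos hq _).le)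
    | succ j ih =>
      obtain ⟨T, M, Θ, σ, Yj, Fj, hYj, hFj, hT0, hT, hM, hMlow, hΘ, hΘle, hypj, hlifej⟩ := ih
      obtain ⟨τ₁, μ₁, hc⟩ := hN₀ n₀ hn₀ (N + j) (by omega) σ Yj Fj hypj
      have hμ := hc.mu_pos (by linarith)
      have hτ₁ : 0 < τ₁ := by linarith [hc.tau_ge]
      set θ : ℝ := ((1 + ε₀) ^ ((5 : ℝ) / 2) * μ₁)⁻¹ with hθ
      have hθp : 0 < θ := theta_pos hε₀ hμ hθ
      set σ' : ℤ → ℝ := fun k => (Function.update σ 1 τ₁ (k + 1) - τ₁) / θ with hσ'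
      set Yj' : Fin 4 → ℤ → ℝ → ℝ :=
        fun i k t => (M * μ₁)⁻¹ * Y i (k + ((j + 1 : ℕ) : ℤ)) (T + Θ * τ₁ + Θ * θ * t) with hYj'
      set Fj' : ℤ → ℝ → ℝ :=
        fun k t => ((M * μ₁) ^ 2)⁻¹ * F (k + ((j + 1 : ℕ) : ℤ)) (T + Θ * τ₁ + Θ * θ * t)
        with hFj'
      have hY' : ∀ i k t, Yj' i k t = μ₁⁻¹ * Yj i (k + 1) (τ₁ + θ * t) := by
        intro i k t
        rw [hYj, show k + 1 + ((j : ℕ) : ℤ) = k + ((j + 1 : ℕ) : ℤ) by push_cast; ring,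
          show T + Θ * (τ₁ + θ * t) = T + Θ * τ₁ + Θ * θ * t by ring]
        simp only [hYj', mul_inv]
        ring
      have hF' : ∀ k t, Fj' k t = (μ₁ ^ 2)⁻¹ * Fj (k + 1) (τ₁ + θ * t) := by
        intro k t
        rw [hFj, show k + 1 + ((j : ℕ) : ℤ) = k + ((j + 1 : ℕ) : ℤ) by push_cast; ring,
          show T + Θ * (τ₁ + θ * t) = T + Θ * τ₁ + Θ * θ * t by ring]
        simp only [hFj', mul_pow, mul_inv]
        ring
      obtain ⟨hyp', hlife'⟩ := hypj.succ hε₀ hKpos (by omega) hc hθ (fun k => rfl) hY' hF'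
        hL100 hlifej le_rfl
      have hlev : N + ((j + 1 : ℕ) : ℤ) = N + (j : ℕ) + 1 := by push_cast; ring
      refine ⟨T + Θ * τ₁, M * μ₁, Θ * θ, σ', Yj', Fj', fun i k t => rfl, fun k t => rfl,
        ?_, ?_, mul_pos hM hμ, ?_, mul_pos hΘ hθp, ?_, ?_, ?_⟩
      · positivity
      · rw [Finset.sum_range_succ, mul_add]
        have : Θ * τ₁ ≤ ρ ^ j * 100 := mul_le_mul hΘle hc.tau_le hτ₁.le (pow_nonneg hρpos.le _)
        linarith
      · have e : (1 + ε₀) ^ (-(((j + 1 : ℕ)) : ℝ) / 100) =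
            (1 + ε₀) ^ (-(j : ℝ) / 100) * (1 + ε₀) ^ (-(1 : ℝ) / 100) := by
          rw [← Real.rpow_add hq]; congr 1; push_cast; ring
        rw [e]
        exact mul_le_mul hMlow hc.mu_ge (Real.rpow_pos_of_pos hq _).le hM.le
      · rw [pow_succ]
        have hθρ : θ ≤ ρ := by
          rw [hθ, mul_inv, hρ, show -(5 : ℝ) / 2 + 1 / 100 = -((5 : ℝ) / 2) + 1 / 100 by ring,
            Real.rpow_add hq, Real.rpow_neg hq.le]
          exact mul_le_mul_of_nonneg_left (inv_mu_le hε₀ hc.mu_ge)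
            (inv_pos.mpr (Real.rpow_pos_of_pos hq _)).le
        exact mul_le_mul hΘle hθρ hθp.le (pow_nonneg hρpos.le _)
      · rw [hlev]; exact hyp'
      · rw [hlev]; exact hlife'
  -- the a priori bound at the starting level, on a time interval containing every `T_j`
  have hτ0 : τ (n₀ - N) ≤ 0 := hyp.tau_le (n₀ - N) le_rfl (by omega)
  set Tmax : ℝ := 100 * (1 / (1 - ρ)) + 1 with hTmax
  have hTpos : 0 < Tmax := by
    have : 0 ≤ 100 * (1 / (1 - ρ)) := by
      have : 0 < 1 - ρ := by linarith
      positivity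
    linarith
  obtain ⟨Mb, hMb⟩ := hyp.apriori_Y Tmax (by linarith)
  have hbound : ∀ j : ℕ, (1 + ε₀) ^ ((999 : ℝ) / 100 * j) ≤ Mb := by
    intro j
    obtain ⟨T, M, Θ, σ, Yj, Fj, hYj, -, hT0, hT, hM, hMlow, -, -, hypj, -⟩ := hP j
    have ha := hypj.a_eq
    rw [hYj, zero_add, mul_zero, add_zero, inv_mul_eq_one₀ hM.ne'] at ha
    have hTm : T ∈ Icc (τ (n₀ - N)) Tmax := by
      refine ⟨hτ0.trans hT0, hT.trans ?_⟩
      have := geom_sum_le_inv_one_sub hρpos.le hρ1 j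
      have : 100 * ∑ i ∈ Finset.range j, ρ ^ i ≤ 100 * (1 / (1 - ρ)) := by gcongr
      linarith
    have hb := hMb T hTm (j : ℤ)
    have hw0 : 0 ≤ (1 + ε₀) ^ ((10 : ℝ) * ((j : ℤ) : ℝ)) := (Real.rpow_pos_of_pos hq _).le
    have ha1 := abs_nonneg (Y 1 (j : ℤ) T)
    have ha2 := abs_nonneg (Y 2 (j : ℤ) T)
    have ha3 := abs_nonneg (Y 3 (j : ℤ) T)
    have hsum : (1 + ε₀) ^ ((10 : ℝ) * ((j : ℤ) : ℝ)) * |Y 0 (j : ℤ) T| ≤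
        (1 + (1 + ε₀) ^ ((10 : ℝ) * ((j : ℤ) : ℝ))) *
          (|Y 0 (j : ℤ) T| + |Y 1 (j : ℤ) T| + |Y 2 (j : ℤ) T| + |Y 3 (j : ℤ) T|) :=
      mul_le_mul (by linarith) (by linarith) (abs_nonneg _) (by linarith)
    calc (1 + ε₀) ^ ((999 : ℝ) / 100 * j)
        = (1 + ε₀) ^ ((10 : ℝ) * ((j : ℤ) : ℝ)) * (1 + ε₀) ^ (-(j : ℝ) / 100) := by
          rw [← Real.rpow_add hq]; congr 1; push_cast; ring
      _ ≤ (1 + ε₀) ^ ((10 : ℝ) * ((j : ℤ) : ℝ)) * M := by gcongr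
      _ = (1 + ε₀) ^ ((10 : ℝ) * ((j : ℤ) : ℝ)) * |Y 0 (j : ℤ) T| := by rw [← ha, abs_of_pos hM]
      _ ≤ Mb := hsum.trans hb
  -- Bernoulli: `(1+ε₀)^{(999/100) j} ≥ 1 + (999/100) j ε₀ > Mb` for `j` large
  obtain ⟨j, hj⟩ := exists_nat_gt (max 1 (Mb / ε₀ + 1))
  have hj1 : (1 : ℝ) < j := (le_max_left _ _).trans_lt hj
  have hj2 : Mb / ε₀ + 1 < j := (le_max_right _ _).trans_lt hj
  have hp : (1 : ℝ) ≤ (999 : ℝ) / 100 * j := by nlinarith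
  have hbern := one_add_mul_self_le_rpow_one_add (s := ε₀) (by linarith) hp
  have hle := hbound j
  have hMε : Mb < (999 : ℝ) / 100 * j * ε₀ := by
    rw [div_add_one (ne_of_gt hε₀), div_lt_iff₀ hε₀] at hj2
    nlinarith
  linarith

/-- **Prop. 6.5 with coefficient `γ` implies Prop. 6.5 with any smaller coefficient `γ' ≤ γ`**
(pointwise in `K > 0`), vacuously: the hypotheses with `γ'` are hypotheses with `γ`, and those
are unsatisfiable in the regime by `not_rescaledHypotheses_of_rescaledStepWith`.
[cite: Tao2016AveragedNS, §6.4 Prop. 6.5] -/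
theorem rescaledStepWith_anti {γ γ' : ℝ → ℝ} (hγ : ∀ K, 0 < K → γ' K ≤ γ K)
    (h65 : rescaledStepWith γ) : rescaledStepWith γ' := by
  intro ε₀ hε₀ hε₀1
  obtain ⟨K₀, hK⟩ := not_rescaledHypotheses_of_rescaledStepWith h65 ε₀ hε₀ hε₀1
  refine ⟨K₀, fun K hK₀K hKpos => ?_⟩
  obtain ⟨e₀, he₀, hε⟩ := hK K hK₀K hKpos
  refine ⟨e₀, he₀, fun ε hεpos hεle C₁ C₂ C₃ hC₁ hC₂ hC₃ => ?_⟩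
  obtain ⟨N₀, hN₀⟩ := hε ε hεpos hεle C₁ C₂ C₃ hC₁ hC₂ hC₃
  refine ⟨N₀, fun n₀ hn₀ N hN τ Y F hyp => ?_⟩
  exact absurd (hyp.mono hε₀ (hγ K hKpos) le_rfl) (hN₀ n₀ hn₀ N hN τ Y F)

/-- **The corrected-coefficient instance of the uniform schema implies the printed-coefficient one**
(`10⁻⁵ exp(-K¹⁰) ≤ 10⁻⁵ exp(-K¹⁰/2)`), vacuously: once `rescaledStepWith (fun K => 10⁻⁵ exp(-K¹⁰/2))`
holds, the hypotheses with the printed coefficient are unsatisfiable in the parameter regime. (That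
the printed constant in (6.71) is not established by the printed proof is the author-acknowledged
erratum recorded in `TaoCascadeBlowupDynamicsWith.lean`. Hypothesis and conclusion are the bodies of
the closed names `rescaledStepCorrected`, `rescaledStepPrinted` of `TaoCascadeRescaled.lean`, deprecated
on 2026-08-15 — mis-stated: `K₀` uniform in `C₃` — and therefore spelled out; the name is kept.)
[cite: Tao2016AveragedNS, §6.4 Prop. 6.5; §6.6 Prop. 6.13 (6.117)] -/
theorem rescaledStepPrinted_of_corrected
    (h : rescaledStepWith fun K => 1 / 10 ^ 5 * Real.exp (-K ^ 10 / 2)) :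
    rescaledStepWith fun K => 1 / 10 ^ 5 * Real.exp (-K ^ 10) := by
  refine rescaledStepWith_anti (fun K _ => ?_) h
  have h1 : Real.exp (-K ^ 10) ≤ Real.exp (-K ^ 10 / 2) := by
    apply Real.exp_le_exp.mpr
    have : 0 ≤ K ^ 10 := by positivity
    linarith
  have h0 : (0 : ℝ) ≤ 1 / 10 ^ 5 := by norm_num
  exact mul_le_mul_of_nonneg_left h1 h0

/-- In particular both instances make the printed hypotheses (i)–(ix) unsatisfiable in the regime;
equivalently, the printed-coefficient instance `rescaledStepWith (fun K => 10⁻⁵ exp(-K¹⁰))` of the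
uniform schema (the body of the deprecated closed name `rescaledStepPrinted`) is equivalent to the
non-existence, in its regime, of data obeying its hypotheses.
[cite: Tao2016AveragedNS, §6.4 Prop. 6.5] -/
theorem rescaledStepPrinted_iff_not_rescaledHypotheses :
    (rescaledStepWith fun K => 1 / 10 ^ 5 * Real.exp (-K ^ 10)) ↔
      ∀ ε₀ : ℝ, 0 < ε₀ → ε₀ < 1 →
        ∃ K₀ : ℝ, ∀ K : ℝ, K₀ ≤ K → 0 < K →
          ∃ e₀ : ℝ, 0 < e₀ ∧ ∀ ε : ℝ, 0 < ε → ε ≤ e₀ →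
            ∀ C₁ C₂ C₃ : ℝ, 0 ≤ C₁ → 0 ≤ C₂ → 0 ≤ C₃ →
              ∃ N₀ : ℤ, ∀ n₀ : ℤ, N₀ ≤ n₀ → ∀ N : ℤ, n₀ ≤ N →
                ∀ (τ : ℤ → ℝ) (Y : Fin 4 → ℤ → ℝ → ℝ) (F : ℤ → ℝ → ℝ),
                  ¬ RescaledHypotheses (1 / 10 ^ 5 * Real.exp (-K ^ 10)) ε₀ K ε C₁ C₂ C₃ n₀ N
                    τ Y F := by
  constructor
  · intro h
    exact not_rescaledHypotheses_of_rescaledStepWith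
      (γ := fun K => 1 / 10 ^ 5 * Real.exp (-K ^ 10)) h
  · intro h ε₀ hε₀ hε₀1
    obtain ⟨K₀, hK⟩ := h ε₀ hε₀ hε₀1
    refine ⟨K₀, fun K hK₀K hKpos => ?_⟩
    obtain ⟨e₀, he₀, hε⟩ := hK K hK₀K hKpos
    refine ⟨e₀, he₀, fun ε hεpos hεle C₁ C₂ C₃ hC₁ hC₂ hC₃ => ?_⟩
    obtain ⟨N₀, hN₀⟩ := hε ε hεpos hεle C₁ C₂ C₃ hC₁ hC₂ hC₃
    refine ⟨N₀, fun n₀ hn₀ N hN τ Y F hyp => ?_⟩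
    exact absurd hyp (hN₀ n₀ hn₀ N hN τ Y F)

end TaoCascade

end Literature.Analysis.FluidPDE
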